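import Literature.Analysis.FluidPDE.PeriodicLerayLimitIdentity
import HarnessLib

/-!
# [BT1] proof of Theorem 2.4, the limit `ε → 0`, VII: the weak formulation (2.2) against `𝒟_T`
  in the limit

Analysis/FluidPDE proof file (theorems only, no new definitions, no named facts), seventh part
of the discharge of the named fact `Literature.Analysis.FluidPDE.bradshawTsai2017_thm_2_4_limit`
(`PeriodicLerayExistence.lean`; Bradshaw–Tsai, Ann. Henri Poincaré 18 (2017) =
arXiv:1510.07504 [BT1], §2, proof of Thm 2.4, with Def. 2.2/(2.2)).

Along `T`-periodic weak solutions `(U_k, p_k, G_k = ∇U_k)` of the mollified perturbed Leray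
systems at scales `ε_k → 0⁺`, with `U_k → U` in `L²` of the cylinders, `η_{ε_k} * U_k → U` in `L³`
of the cylinders and `∇U_k ⇀ ∇U` weakly in `L²` of the slabs `(−m−1, m+1) × ℝ³` (parts II–VI),
the weak formulation (iii) of `IsMollifiedPeriodicWeakSolution.weakForm` passes to the limit
term by term on the cylinder `(0,T) × B(0, R_f)` carrying the test field `f ∈ 𝒟_T`
(`tendsto` of the seven pieces: strong × bounded, weak × bounded, weak × strong for the drift
term `⟪∇U_k (W + η_{ε_k} * U_k), f⟫`), and the profile pairing `⟨LW(s), f(s)⟩` recombines with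
the `W`-terms of `u = U + W`, `∇u = ∇U + ∇W` into `∫₀ᵀ d/ds ∫ ⟪W, f⟫ = 0` (periodicity), which
yields the weak form (2.2) of `IsSuitablePeriodicWeakSolution.weakForm` (iii) for `(u, ∇u)`
(`weakForm_limit`).

## References

* Z. Bradshaw, T.-P. Tsai, Ann. Henri Poincaré 18 (2017) 1095–1119 = arXiv:1510.07504, §2,
  Def. 2.2 and proof of Thm 2.4 [BradshawTsai2017AHP].
* R. Temam, *Navier–Stokes equations* (1977/79), Ch. III, §3 (passage to the limit) [Temam1979].
-/

noncomputable section

open MeasureTheory TopologicalSpace Set Function Filter Metric Bornology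
open scoped NNReal ENNReal Topology InnerProductSpace RealInnerProductSpace

namespace Literature.Analysis.FluidPDE

namespace BradshawTsai2017

/-! ### Weak × strong pairings -/

section WeakStrong

variable {X : Type*} [MeasurableSpace X] {μ : Measure X}
variable {E : Type*} [NormedAddCommGroup E] [InnerProductSpace ℝ E]

/-- **Weakly convergent against strongly convergent**: if `gₖ ⇀ g` weakly in `L²(μ)` (tested
against `L²`), `‖gₖ‖_{L²} ≤ M`, and `hₖ → h` in `L²(μ)`, then `∫ ⟪gₖ, hₖ⟫ → ∫ ⟪g, h⟫`
(`⟪gₖ, hₖ⟫ = ⟪gₖ, h⟫ + ⟪gₖ, hₖ − h⟫` and Cauchy–Schwarz). [folklore] -/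
theorem tendsto_integral_inner_weak_strong {g : ℕ → X → E} {g₀ : X → E}
    (hgm : ∀ k, AEStronglyMeasurable (g k) μ) {M : ℝ≥0∞} (hM : M ≠ ⊤)
    (hgb : ∀ k, eLpNorm (g k) 2 μ ≤ M)
    (hw : ∀ h : X → E, MemLp h 2 μ → Tendsto (fun k => ∫ x, ⟪g k x, h x⟫ ∂μ) atTop (𝓝 (∫ x, ⟪g₀ x, h x⟫ ∂μ)))
    {h : ℕ → X → E} {h₀ : X → E} (hh : ∀ k, MemLp (h k) 2 μ) (hh₀ : MemLp h₀ 2 μ)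
    (hhl : Tendsto (fun k => eLpNorm (h k - h₀) 2 μ) atTop (𝓝 0)) :
    Tendsto (fun k => ∫ x, ⟪g k x, h k x⟫ ∂μ) atTop (𝓝 (∫ x, ⟪g₀ x, h₀ x⟫ ∂μ)) := by
  have hgmem : ∀ k, MemLp (g k) 2 μ := fun k => ⟨hgm k, (hgb k).trans_lt hM.lt_top⟩
  have hint : ∀ {a b : X → E}, MemLp a 2 μ → MemLp b 2 μ → Integrable (fun x => ⟪a x, b x⟫) μ := by
    intro a b ha hb
    exact (ha.norm.integrable_mul hb.norm).mono' (ha.1.inner hb.1) (Eventually.of_forall fun x => norm_inner_le_norm _ _)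
  -- split `⟪g k, h k⟫ = ⟪g k, h₀⟫ + ⟪g k, h k - h₀⟫`
  have hsplit : ∀ k, ∫ x, ⟪g k x, h k x⟫ ∂μ = (∫ x, ⟪g k x, h₀ x⟫ ∂μ) + ∫ x, ⟪g k x, h k x - h₀ x⟫ ∂μ := by
    intro k
    have h2 : Integrable (fun x => ⟪g k x, h k x - h₀ x⟫) μ := hint (hgmem k) ((hh k).sub hh₀)
    rw [← integral_add (hint (hgmem k) hh₀) h2]
    refine integral_congr_ae (Eventually.of_forall fun x => ?_)
    show ⟪g k x, h k x⟫ = ⟪g k x, h₀ x⟫ + ⟪g k x, h k x - h₀ x⟫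
    rw [← inner_add_right, add_sub_cancel]
  simp_rw [hsplit]
  rw [← add_zero (∫ x, ⟪g₀ x, h₀ x⟫ ∂μ)]
  refine (hw h₀ hh₀).add ?_
  -- the remainder tends to zero
  have hb : ∀ k, ‖∫ x, ⟪g k x, h k x - h₀ x⟫ ∂μ‖ ≤ (M * eLpNorm (h k - h₀) 2 μ).toReal := by
    intro k
    have hfin : M * eLpNorm (h k - h₀) 2 μ ≠ ⊤ := ENNReal.mul_ne_top hM ((hh k).sub hh₀).eLpNorm_ne_top
    rw [Real.norm_eq_abs]
    refine abs_integral_le_toReal_of_lintegral_le hfin ?_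
    calc ∫⁻ x, ‖⟪g k x, h k x - h₀ x⟫‖ₑ ∂μ ≤ ∫⁻ x, ‖g k x‖ₑ * ‖h k x - h₀ x‖ₑ ∂μ := by
          refine lintegral_mono fun x => ?_
          rw [← ofReal_norm, ← ofReal_norm, ← ofReal_norm, ← ENNReal.ofReal_mul (norm_nonneg _)]
          exact ENNReal.ofReal_le_ofReal (norm_inner_le_norm _ _)
      _ ≤ (∫⁻ x, ‖g k x‖ₑ ^ (2 : ℝ) ∂μ) ^ (1 / (2 : ℝ)) * (∫⁻ x, ‖h k x - h₀ x‖ₑ ^ (2 : ℝ) ∂μ) ^ (1 / (2 : ℝ)) :=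
          ENNReal.lintegral_mul_le_Lp_mul_Lq μ Real.HolderConjugate.two_two (hgm k).enorm ((hh k).1.sub hh₀.1).enorm
      _ = eLpNorm (g k) 2 μ * eLpNorm (h k - h₀) 2 μ := by
          rw [← FunctionSpaces.lintegral_rpow_two_eq_eLpNorm, ← FunctionSpaces.lintegral_rpow_two_eq_eLpNorm]; rfl
      _ ≤ M * eLpNorm (h k - h₀) 2 μ := mul_le_mul' (hgb k) le_rfl
  have hlim : Tendsto (fun k => (M * eLpNorm (h k - h₀) 2 μ).toReal) atTop (𝓝 0) := by
    have h1 := ENNReal.Tendsto.const_mul hhl (a := M) (Or.inr hM)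
    rw [mul_zero] at h1
    have h2 := (ENNReal.tendsto_toReal ENNReal.zero_ne_top).comp h1
    rwa [ENNReal.toReal_zero] at h2
  exact squeeze_zero_norm hb hlim

end WeakStrong

/-! ### The test class `𝒟_T`: supports, continuity and bounds of the weights -/

section TestClass

variable {T : ℝ} {f : ℝ → EuclideanSpace ℝ (Fin 3) → EuclideanSpace ℝ (Fin 3)}

/-- A field of `𝒟_T` and its weights `∂ₛf`, `Df` vanish outside a ball `B(0, R_f)`, uniformly in
`s`. [folklore] -/
theorem IsPeriodicDivFreeTest.exists_ball (hf : IsPeriodicDivFreeTest T f) :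
    ∃ Rf : ℝ, 0 < Rf ∧ ∀ s (y : EuclideanSpace ℝ (Fin 3)), y ∉ ball (0 : EuclideanSpace ℝ (Fin 3)) Rf →
      f s y = 0 ∧ fderiv ℝ (f s) y = 0 ∧ timeDeriv f s y = 0 := by
  obtain ⟨R, hR⟩ := hf.compact_support
  refine ⟨|R| + 1, by positivity, fun s y hy => ?_⟩
  rw [mem_ball_zero_iff, not_lt] at hy
  have hzero : ∀ (τ : ℝ) (w : EuclideanSpace ℝ (Fin 3)), |R| ≤ ‖w‖ → f τ w = 0 := fun τ w hw =>
    hR τ w ((le_abs_self R).trans hw)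
  have hts : tsupport (f s) ⊆ closedBall (0 : EuclideanSpace ℝ (Fin 3)) |R| := by
    refine closure_minimal (fun w hw => ?_) isClosed_closedBall
    rw [mem_closedBall_zero_iff]
    by_contra h
    exact hw (hzero s w (not_le.1 h).le)
  have hy' : y ∉ tsupport (f s) := fun h => by
    have := mem_closedBall_zero_iff.1 (hts h); linarith
  refine ⟨hzero s y (by linarith), fderiv_of_notMem_tsupport ℝ hy', ?_⟩
  rw [timeDeriv]
  have : (fun τ => f τ y) = fun _ => 0 := funext fun τ => hzero τ y (by linarith)
  rw [this, deriv_const]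

/-- The time derivative of a `C¹` space–time field is the partial derivative `D(f)(s,y)(1,0)`,
hence continuous. [folklore] -/
theorem timeDeriv_eq_fderiv_uncurry (hf : ContDiff ℝ 1 (uncurry f)) (s : ℝ) (y : EuclideanSpace ℝ (Fin 3)) :
    timeDeriv f s y = fderiv ℝ (uncurry f) (s, y) ((1 : ℝ), (0 : EuclideanSpace ℝ (Fin 3))) := by
  rw [timeDeriv, (hasDerivAt_profile_time hf s y).deriv]

/-- Continuity of `(s, y) ↦ ∂ₛf(s, y)` for a `C¹` field. [folklore] -/
theorem continuous_timeDeriv_of_contDiff_one (hf : ContDiff ℝ 1 (uncurry f)) :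
    Continuous fun z : ℝ × EuclideanSpace ℝ (Fin 3) => timeDeriv f z.1 z.2 := by
  have h : (fun z : ℝ × EuclideanSpace ℝ (Fin 3) => timeDeriv f z.1 z.2) =
      fun z => fderiv ℝ (uncurry f) z ((1 : ℝ), (0 : EuclideanSpace ℝ (Fin 3))) := by
    funext z; exact timeDeriv_eq_fderiv_uncurry hf z.1 z.2
  rw [h]
  exact (hf.continuous_fderiv one_ne_zero).clm_apply continuous_const

/-- **A continuous space–time field vanishing outside `ℝ × B(0, R)` is bounded on every time
window** `[a, b] × ℝ³`. [folklore] -/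
theorem exists_bound_on_window {F' : Type*} [NormedAddCommGroup F'] {F : ℝ × EuclideanSpace ℝ (Fin 3) → F'}
    (hF : Continuous F) {R : ℝ} (hR : ∀ z : ℝ × EuclideanSpace ℝ (Fin 3), z.2 ∉ ball (0 : EuclideanSpace ℝ (Fin 3)) R → F z = 0)
    (a b : ℝ) : ∃ C : ℝ, 0 ≤ C ∧ ∀ z : ℝ × EuclideanSpace ℝ (Fin 3), z.1 ∈ Icc a b → ‖F z‖ ≤ C := by
  obtain ⟨C, hC⟩ := ((isCompact_Icc (a := a) (b := b)).prod (isCompact_closedBall (0 : EuclideanSpace ℝ (Fin 3)) R)).exists_bound_of_continuousOn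
    hF.continuousOn
  refine ⟨max C 0, le_max_right _ _, fun z hz => ?_⟩
  by_cases hy : z.2 ∈ ball (0 : EuclideanSpace ℝ (Fin 3)) R
  · exact (hC z ⟨hz, ball_subset_closedBall hy⟩).trans (le_max_left _ _)
  · rw [hR z hy, norm_zero]; exact le_max_right _ _

/-- A continuous space–time integrand vanishing outside `ℝ × B(0, R)` is integrable in `y` at
every `s`. [folklore] -/
theorem integrable_slice_of_continuous_of_ball {F' : Type*} [NormedAddCommGroup F'] [NormedSpace ℝ F']
    {F : ℝ × EuclideanSpace ℝ (Fin 3) → F'} (hF : Continuous F) {R : ℝ}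
    (hR : ∀ z : ℝ × EuclideanSpace ℝ (Fin 3), z.2 ∉ ball (0 : EuclideanSpace ℝ (Fin 3)) R → F z = 0) (s : ℝ) :
    Integrable (fun y => F (s, y)) (volume : Measure (EuclideanSpace ℝ (Fin 3))) := by
  have hc : Continuous fun y => F (s, y) := hF.comp (continuous_const.prodMk continuous_id)
  refine hc.integrable_of_hasCompactSupport ?_
  exact HasCompactSupport.intro (isCompact_closedBall (0 : EuclideanSpace ℝ (Fin 3)) R) fun y hy =>
    hR (s, y) fun h => hy (ball_subset_closedBall h)

/-- **The `y`-integral of a continuous space–time integrand vanishing outside `ℝ × B(0, R)` is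
bounded and measurable in `s`, hence integrable on every bounded time interval.** [folklore] -/
theorem integrableOn_integral_slice {F' : Type*} [NormedAddCommGroup F'] [NormedSpace ℝ F']
    {F : ℝ × EuclideanSpace ℝ (Fin 3) → F'} (hF : Continuous F) {R : ℝ}
    (hR : ∀ z : ℝ × EuclideanSpace ℝ (Fin 3), z.2 ∉ ball (0 : EuclideanSpace ℝ (Fin 3)) R → F z = 0) (a b : ℝ) :
    IntegrableOn (fun s => ∫ y, F (s, y)) (Ioo a b) (volume : Measure ℝ) := by
  obtain ⟨C, hC0, hC⟩ := exists_bound_on_window hF hR a b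
  have hm : AEStronglyMeasurable (fun s => ∫ y, F (s, y)) (volume : Measure ℝ) :=
    (hF.stronglyMeasurable.integral_prod_right' (ν := (volume : Measure (EuclideanSpace ℝ (Fin 3))))).aestronglyMeasurable
  refine Measure.integrableOn_of_bounded (M := C * (volume (ball (0 : EuclideanSpace ℝ (Fin 3)) R)).toReal)
    (by rw [Real.volume_Ioo]; exact ENNReal.ofReal_ne_top) hm ?_
  filter_upwards [ae_restrict_mem measurableSet_Ioo] with s hs
  rw [← setIntegral_eq_integral_of_forall_compl_eq_zero (s := ball (0 : EuclideanSpace ℝ (Fin 3)) R)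
    (fun y hy => hR (s, y) hy)]
  exact norm_setIntegral_le_of_norm_le_const measure_ball_lt_top fun y _ => hC (s, y) (Ioo_subset_Icc_self hs)

variable {W : ℝ → EuclideanSpace ℝ (Fin 3) → EuclideanSpace ℝ (Fin 3)}

/-- **The profile pairing recombines with the `W`-terms of the limit**: for every `s`,
`⟨LW(s), f(s)⟩ + ∫ (⟪W, ∂ₛf⟫ − DW:Df + ⟪W + (y·∇)W, f⟫) = ∫ (⟪W, ∂ₛf⟫ + ⟪∂ₛW, f⟫)`. [folklore] -/
theorem lerayPairing_add_integral_eq (hW : ContDiff ℝ 1 (uncurry W)) (hf1 : ContDiff ℝ 1 (uncurry f)) {Rf : ℝ}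
    (hRf : ∀ s (y : EuclideanSpace ℝ (Fin 3)), y ∉ ball (0 : EuclideanSpace ℝ (Fin 3)) Rf →
      f s y = 0 ∧ fderiv ℝ (f s) y = 0 ∧ timeDeriv f s y = 0) (s : ℝ) :
    lerayPairing W s (f s) + ∫ y, (⟪W s y, timeDeriv f s y⟫ - frobeniusInner (fderiv ℝ (W s) y) (fderiv ℝ (f s) y) +
        ⟪W s y + fderiv ℝ (W s) y y, f s y⟫) =
      ∫ y, (⟪W s y, timeDeriv f s y⟫ + ⟪timeDeriv W s y, f s y⟫) := by
  have happ : Continuous (uncurry fun (L : EuclideanSpace ℝ (Fin 3) →L[ℝ] EuclideanSpace ℝ (Fin 3)) (v : EuclideanSpace ℝ (Fin 3)) => L v) :=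
    isBoundedBilinearMap_apply.continuous
  -- continuity of the building blocks as space–time fields
  have cW : Continuous fun z : ℝ × EuclideanSpace ℝ (Fin 3) => W z.1 z.2 := hW.continuous
  have cWt : Continuous fun z : ℝ × EuclideanSpace ℝ (Fin 3) => timeDeriv W z.1 z.2 := continuous_timeDeriv_of_contDiff_one hW
  have cDW : Continuous fun z : ℝ × EuclideanSpace ℝ (Fin 3) => fderiv ℝ (W z.1) z.2 := continuous_fderiv_slice_of_contDiff hW
  have cf : Continuous fun z : ℝ × EuclideanSpace ℝ (Fin 3) => f z.1 z.2 := hf1.continuous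
  have cft : Continuous fun z : ℝ × EuclideanSpace ℝ (Fin 3) => timeDeriv f z.1 z.2 := continuous_timeDeriv_of_contDiff_one hf1
  have cDf : Continuous fun z : ℝ × EuclideanSpace ℝ (Fin 3) => fderiv ℝ (f z.1) z.2 := continuous_fderiv_slice_of_contDiff hf1
  have cDWy : Continuous fun z : ℝ × EuclideanSpace ℝ (Fin 3) => fderiv ℝ (W z.1) z.2 z.2 := happ.comp (cDW.prodMk continuous_snd)
  have cfrob : Continuous fun z : ℝ × EuclideanSpace ℝ (Fin 3) => frobeniusInner (fderiv ℝ (W z.1) z.2) (fderiv ℝ (f z.1) z.2) := by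
    simp only [frobeniusInner]
    refine continuous_finsetSum _ fun i _ => ?_
    exact (cDW.clm_apply continuous_const).inner (cDf.clm_apply continuous_const)
  -- the two integrands
  set F₁ : ℝ × EuclideanSpace ℝ (Fin 3) → ℝ := fun z =>
    ⟪timeDeriv W z.1 z.2 - W z.1 z.2 - fderiv ℝ (W z.1) z.2 z.2, f z.1 z.2⟫ +
      frobeniusInner (fderiv ℝ (W z.1) z.2) (fderiv ℝ (f z.1) z.2) with hF₁
  set F₂ : ℝ × EuclideanSpace ℝ (Fin 3) → ℝ := fun z =>
    ⟪W z.1 z.2, timeDeriv f z.1 z.2⟫ - frobeniusInner (fderiv ℝ (W z.1) z.2) (fderiv ℝ (f z.1) z.2) +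
      ⟪W z.1 z.2 + fderiv ℝ (W z.1) z.2 z.2, f z.1 z.2⟫ with hF₂
  have c₁ : Continuous F₁ := (((cWt.sub cW).sub cDWy).inner cf).add cfrob
  have c₂ : Continuous F₂ := ((cW.inner cft).sub cfrob).add ((cW.add cDWy).inner cf)
  have hz₁ : ∀ z : ℝ × EuclideanSpace ℝ (Fin 3), z.2 ∉ ball (0 : EuclideanSpace ℝ (Fin 3)) Rf → F₁ z = 0 := by
    intro z hz
    obtain ⟨h1, h2, -⟩ := hRf z.1 z.2 hz
    simp only [hF₁, h1, h2, inner_zero_right, frobeniusInner_zero_right, add_zero]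
  have hz₂ : ∀ z : ℝ × EuclideanSpace ℝ (Fin 3), z.2 ∉ ball (0 : EuclideanSpace ℝ (Fin 3)) Rf → F₂ z = 0 := by
    intro z hz
    obtain ⟨h1, h2, h3⟩ := hRf z.1 z.2 hz
    simp only [hF₂, h1, h2, h3, inner_zero_right, frobeniusInner_zero_right, sub_zero, add_zero]
  have i₁ := integrable_slice_of_continuous_of_ball c₁ hz₁ s
  have i₂ := integrable_slice_of_continuous_of_ball c₂ hz₂ s
  rw [lerayPairing]
  change (∫ y, F₁ (s, y)) + ∫ y, F₂ (s, y) = _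
  rw [← integral_add i₁ i₂]
  refine integral_congr_ae (Eventually.of_forall fun y => ?_)
  simp only [hF₁, hF₂, inner_sub_left, inner_add_left]
  ring

/-- **`∫₀ᵀ d/ds ∫ ⟪W, f⟫ dy ds = 0` for `T`-periodic `C¹` fields `W` and `f ∈ 𝒟_T`** (differentiation
under the integral sign, the fundamental theorem of calculus, and periodicity). [folklore] -/
theorem integral_Ioo_deriv_pairing_eq_zero (hT : 0 < T) (hW : ContDiff ℝ 1 (uncurry W))
    (hWper : ∀ s y, W (s + T) y = W s y) (hf1 : ContDiff ℝ 1 (uncurry f)) (hfper : ∀ s y, f (s + T) y = f s y)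
    {Rf : ℝ} (hRf : ∀ s (y : EuclideanSpace ℝ (Fin 3)), y ∉ ball (0 : EuclideanSpace ℝ (Fin 3)) Rf →
      f s y = 0 ∧ fderiv ℝ (f s) y = 0 ∧ timeDeriv f s y = 0) :
    ∫ s in Ioo 0 T, ∫ y, (⟪W s y, timeDeriv f s y⟫ + ⟪timeDeriv W s y, f s y⟫) = 0 := by
  have cW : Continuous fun z : ℝ × EuclideanSpace ℝ (Fin 3) => W z.1 z.2 := hW.continuous
  have cWt : Continuous fun z : ℝ × EuclideanSpace ℝ (Fin 3) => timeDeriv W z.1 z.2 := continuous_timeDeriv_of_contDiff_one hW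
  have cf : Continuous fun z : ℝ × EuclideanSpace ℝ (Fin 3) => f z.1 z.2 := hf1.continuous
  have cft : Continuous fun z : ℝ × EuclideanSpace ℝ (Fin 3) => timeDeriv f z.1 z.2 := continuous_timeDeriv_of_contDiff_one hf1
  -- the pairing and its derivative
  set Φ : ℝ × EuclideanSpace ℝ (Fin 3) → ℝ := fun z => ⟪W z.1 z.2, f z.1 z.2⟫ with hΦ
  set Φ' : ℝ × EuclideanSpace ℝ (Fin 3) → ℝ := fun z => ⟪W z.1 z.2, timeDeriv f z.1 z.2⟫ + ⟪timeDeriv W z.1 z.2, f z.1 z.2⟫ with hΦ'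
  have cΦ : Continuous Φ := cW.inner cf
  have cΦ' : Continuous Φ' := (cW.inner cft).add (cWt.inner cf)
  have hzΦ : ∀ z : ℝ × EuclideanSpace ℝ (Fin 3), z.2 ∉ ball (0 : EuclideanSpace ℝ (Fin 3)) Rf → Φ z = 0 := fun z hz => by
    simp only [hΦ, (hRf z.1 z.2 hz).1, inner_zero_right]
  have hzΦ' : ∀ z : ℝ × EuclideanSpace ℝ (Fin 3), z.2 ∉ ball (0 : EuclideanSpace ℝ (Fin 3)) Rf → Φ' z = 0 := fun z hz => by
    simp only [hΦ', (hRf z.1 z.2 hz).1, (hRf z.1 z.2 hz).2.2, inner_zero_right, add_zero]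
  set φ : ℝ → ℝ := fun s => ∫ y, Φ (s, y) with hφ
  -- differentiation under the integral sign
  have hderiv : ∀ s₀ : ℝ, HasDerivAt φ (∫ y, Φ' (s₀, y)) s₀ := by
    intro s₀
    -- bounds on the time window `[s₀ - 1, s₀ + 1]`
    obtain ⟨M, hM0, hMW, -⟩ := exists_profile_bound hW (s₀ - 1) (s₀ + 1) (0 : EuclideanSpace ℝ (Fin 3)) Rf
    obtain ⟨Mt, hMt⟩ := ((isCompact_Icc (a := s₀ - 1) (b := s₀ + 1)).prod
      (isCompact_closedBall (0 : EuclideanSpace ℝ (Fin 3)) Rf)).exists_bound_of_continuousOn cWt.continuousOn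
    obtain ⟨Cf, hCf0, hCf⟩ := exists_bound_on_window cf (fun z hz => (hRf z.1 z.2 hz).1) (s₀ - 1) (s₀ + 1)
    obtain ⟨Cft, hCft0, hCft⟩ := exists_bound_on_window cft (fun z hz => (hRf z.1 z.2 hz).2.2) (s₀ - 1) (s₀ + 1)
    set K : ℝ := M * Cft + |Mt| * Cf with hK
    have hbound : ∀ᵐ y : EuclideanSpace ℝ (Fin 3), ∀ s ∈ ball s₀ 1,
        ‖Φ' (s, y)‖ ≤ (ball (0 : EuclideanSpace ℝ (Fin 3)) Rf).indicator (fun _ => K) y := by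
      refine Eventually.of_forall fun y s hs => ?_
      have hsI : s ∈ Icc (s₀ - 1) (s₀ + 1) := by
        rw [mem_ball, Real.dist_eq] at hs
        constructor <;> linarith [abs_lt.1 hs |>.1, abs_lt.1 hs |>.2]
      by_cases hy : y ∈ ball (0 : EuclideanSpace ℝ (Fin 3)) Rf
      · rw [indicator_of_mem hy]
        have hy' : y ∈ closedBall (0 : EuclideanSpace ℝ (Fin 3)) Rf := ball_subset_closedBall hy
        calc ‖Φ' (s, y)‖ ≤ ‖⟪W s y, timeDeriv f s y⟫‖ + ‖⟪timeDeriv W s y, f s y⟫‖ := norm_add_le _ _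
          _ ≤ ‖W s y‖ * ‖timeDeriv f s y‖ + ‖timeDeriv W s y‖ * ‖f s y‖ :=
              add_le_add (norm_inner_le_norm _ _) (norm_inner_le_norm _ _)
          _ ≤ M * Cft + |Mt| * Cf := by
              refine add_le_add (mul_le_mul (hMW s hsI y hy') (hCft (s, y) hsI) (norm_nonneg _) hM0)
                (mul_le_mul ((hMt (s, y) ⟨hsI, hy'⟩).trans (le_abs_self _)) (hCf (s, y) hsI) (norm_nonneg _) (abs_nonneg _))
      · rw [indicator_of_notMem hy, hzΦ' (s, y) hy, norm_zero]
    have hdiff : ∀ᵐ y : EuclideanSpace ℝ (Fin 3), ∀ s ∈ ball s₀ 1, HasDerivAt (fun s => Φ (s, y)) (Φ' (s, y)) s := by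
      refine Eventually.of_forall fun y s _ => ?_
      have h1 : HasDerivAt (fun s => W s y) (timeDeriv W s y) s := by
        rw [timeDeriv_eq_fderiv_uncurry hW]; exact hasDerivAt_profile_time hW s y
      have h2 : HasDerivAt (fun s => f s y) (timeDeriv f s y) s := by
        rw [timeDeriv_eq_fderiv_uncurry hf1]; exact hasDerivAt_profile_time hf1 s y
      exact h1.inner ℝ h2
    have hmeas : ∀ s, AEStronglyMeasurable (fun y => Φ (s, y)) (volume : Measure (EuclideanSpace ℝ (Fin 3))) :=
      fun s => (cΦ.comp (continuous_const.prodMk continuous_id)).aestronglyMeasurable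
    have hmeas' : AEStronglyMeasurable (fun y => Φ' (s₀, y)) (volume : Measure (EuclideanSpace ℝ (Fin 3))) :=
      (cΦ'.comp (continuous_const.prodMk continuous_id)).aestronglyMeasurable
    haveI : IsFiniteMeasure ((volume : Measure (EuclideanSpace ℝ (Fin 3))).restrict (ball (0 : EuclideanSpace ℝ (Fin 3)) Rf)) :=
      ⟨by rw [Measure.restrict_apply_univ]; exact measure_ball_lt_top⟩
    have hbi : Integrable ((ball (0 : EuclideanSpace ℝ (Fin 3)) Rf).indicator fun _ => K) (volume : Measure (EuclideanSpace ℝ (Fin 3))) := by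
      have h1 : IntegrableOn (fun _ : EuclideanSpace ℝ (Fin 3) => K) (ball (0 : EuclideanSpace ℝ (Fin 3)) Rf)
          (volume : Measure (EuclideanSpace ℝ (Fin 3))) := integrable_const K
      exact h1.integrable_indicator measurableSet_ball
    exact (hasDerivAt_integral_of_dominated_loc_of_deriv_le (F := fun s y => Φ (s, y)) (F' := fun s y => Φ' (s, y))
      (ball_mem_nhds s₀ one_pos) (Eventually.of_forall hmeas) (integrable_slice_of_continuous_of_ball cΦ hzΦ s₀)
      hmeas' hbound hbi hdiff).2
  -- the fundamental theorem of calculus on `[0, T]`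
  have hint : IntervalIntegrable (fun s => ∫ y, Φ' (s, y)) volume 0 T :=
    (intervalIntegrable_iff_integrableOn_Ioo_of_le hT.le).2 (integrableOn_integral_slice cΦ' hzΦ' 0 T)
  have hFTC := intervalIntegral.integral_eq_sub_of_hasDerivAt (fun s _ => hderiv s) hint
  have hper : φ T = φ 0 := by
    simp only [hφ, hΦ]
    refine integral_congr_ae (Eventually.of_forall fun y => ?_)
    have h1 := hWper 0 y
    have h2 := hfper 0 y
    rw [zero_add] at h1 h2
    show ⟪W T y, f T y⟫ = ⟪W 0 y, f 0 y⟫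
    rw [h1, h2]
  rw [hper, sub_self, intervalIntegral.integral_of_le hT.le, integral_Ioc_eq_integral_Ioo] at hFTC
  exact hFTC

/-- **A continuous `T`-periodic space–time field vanishing outside `ℝ × B(0, R)` is bounded.**
[folklore] -/
theorem exists_global_bound_of_periodic {F' : Type*} [NormedAddCommGroup F'] {F : ℝ × EuclideanSpace ℝ (Fin 3) → F'}
    (hF : Continuous F) (hT : 0 < T) (hper : ∀ s (y : EuclideanSpace ℝ (Fin 3)), F (s + T, y) = F (s, y)) {R : ℝ}
    (hR : ∀ z : ℝ × EuclideanSpace ℝ (Fin 3), z.2 ∉ ball (0 : EuclideanSpace ℝ (Fin 3)) R → F z = 0) :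
    ∃ C : ℝ, 0 ≤ C ∧ ∀ z : ℝ × EuclideanSpace ℝ (Fin 3), ‖F z‖ ≤ C := by
  obtain ⟨C, hC0, hC⟩ := exists_bound_on_window hF hR 0 T
  refine ⟨C, hC0, fun z => ?_⟩
  have hp : Function.Periodic (fun s => fun y : EuclideanSpace ℝ (Fin 3) => F (s, y)) T :=
    fun s => funext fun y => hper s y
  obtain ⟨s', hs', hs⟩ := hp.exists_mem_Ico₀ hT z.1
  have h1 : F z = F (s', z.2) := by
    have := congrFun hs z.2
    simpa using this
  rw [h1]
  exact hC (s', z.2) (Ico_subset_Icc_self hs')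

end TestClass

/-! ### Frobenius pairings against weakly convergent gradients -/

section Frobenius

/-- `‖L eᵢ‖² ≤ |L|²_F`. [folklore] -/
theorem norm_apply_basis_sq_le_frobeniusNormSq (L : EuclideanSpace ℝ (Fin 3) →L[ℝ] EuclideanSpace ℝ (Fin 3))
    (i : Fin (Module.finrank ℝ (EuclideanSpace ℝ (Fin 3)))) :
    ‖L (stdOrthonormalBasis ℝ (EuclideanSpace ℝ (Fin 3)) i)‖ ^ 2 ≤ frobeniusNormSq L := by
  rw [frobeniusNormSq]
  exact Finset.single_le_sum (f := fun j => ‖L (stdOrthonormalBasis ℝ (EuclideanSpace ℝ (Fin 3)) j)‖ ^ 2)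
    (fun j _ => sq_nonneg _) (Finset.mem_univ i)

/-- `frobeniusInner` is additive in the first slot. [folklore] -/
theorem frobeniusInner_add_left (A A' B : EuclideanSpace ℝ (Fin 3) →L[ℝ] EuclideanSpace ℝ (Fin 3)) :
    frobeniusInner (A + A') B = frobeniusInner A B + frobeniusInner A' B := by
  simp only [frobeniusInner, _root_.add_apply, inner_add_left, Finset.sum_add_distrib]

/-- **`⟪Γ v, u⟫` as a Frobenius pairing** with the rank-one map `x ↦ ⟪v, x⟫ u`:
`⟪Γ v, u⟫ = Γ : (u ⊗ v)`. [folklore] -/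
theorem inner_clm_apply_eq_frobeniusInner_smulRight (Γ : EuclideanSpace ℝ (Fin 3) →L[ℝ] EuclideanSpace ℝ (Fin 3))
    (v u : EuclideanSpace ℝ (Fin 3)) :
    ⟪Γ v, u⟫ = frobeniusInner Γ ((innerSL ℝ v).smulRight u) := by
  conv_lhs => rw [← (stdOrthonormalBasis ℝ (EuclideanSpace ℝ (Fin 3))).sum_repr' v]
  rw [map_sum, sum_inner]
  simp only [frobeniusInner, ContinuousLinearMap.smulRight_apply, innerSL_apply_apply, map_smul, real_inner_smul_left,
    real_inner_smul_right]
  refine Finset.sum_congr rfl fun i _ => ?_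
  rw [real_inner_comm v]

variable {X : Type*} [MeasurableSpace X] {μ : Measure X}

/-- **Frobenius pairings of fields with square integrable columns are integrable.** [folklore] -/
theorem integrable_frobeniusInner_of_columns
    {Γ R : X → EuclideanSpace ℝ (Fin 3) →L[ℝ] EuclideanSpace ℝ (Fin 3)}
    (hΓ : ∀ i, MemLp (fun x => Γ x (stdOrthonormalBasis ℝ (EuclideanSpace ℝ (Fin 3)) i)) 2 μ)
    (hR : ∀ i, MemLp (fun x => R x (stdOrthonormalBasis ℝ (EuclideanSpace ℝ (Fin 3)) i)) 2 μ) :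
    Integrable (fun x => frobeniusInner (Γ x) (R x)) μ := by
  simp only [frobeniusInner]
  refine integrable_finsetSum _ fun i _ => ?_
  exact ((hΓ i).norm.integrable_mul (hR i).norm).mono' ((hΓ i).1.inner (hR i).1)
    (Eventually.of_forall fun x => norm_inner_le_norm _ _)

/-- **Frobenius pairings pass to the limit: weakly convergent gradients against strongly
convergent partners.** If the columns `Γₖ eᵢ` are bounded in `L²(μ)` and converge weakly in
`L²(μ)` to `Γ eᵢ`, and the columns `Rₖ eᵢ → R eᵢ` strongly in `L²(μ)`, then
`∫ Γₖ : Rₖ → ∫ Γ : R`. [folklore] -/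
theorem tendsto_integral_frobeniusInner
    {Γ : ℕ → X → EuclideanSpace ℝ (Fin 3) →L[ℝ] EuclideanSpace ℝ (Fin 3)}
    {Γ₀ : X → EuclideanSpace ℝ (Fin 3) →L[ℝ] EuclideanSpace ℝ (Fin 3)}
    (hΓm : ∀ k i, AEStronglyMeasurable (fun x => Γ k x (stdOrthonormalBasis ℝ (EuclideanSpace ℝ (Fin 3)) i)) μ)
    {M : ℝ≥0∞} (hM : M ≠ ⊤)
    (hΓb : ∀ k i, eLpNorm (fun x => Γ k x (stdOrthonormalBasis ℝ (EuclideanSpace ℝ (Fin 3)) i)) 2 μ ≤ M)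
    (hw : ∀ i (h : X → EuclideanSpace ℝ (Fin 3)), MemLp h 2 μ →
      Tendsto (fun k => ∫ x, ⟪Γ k x (stdOrthonormalBasis ℝ (EuclideanSpace ℝ (Fin 3)) i), h x⟫ ∂μ) atTop
        (𝓝 (∫ x, ⟪Γ₀ x (stdOrthonormalBasis ℝ (EuclideanSpace ℝ (Fin 3)) i), h x⟫ ∂μ)))
    {R : ℕ → X → EuclideanSpace ℝ (Fin 3) →L[ℝ] EuclideanSpace ℝ (Fin 3)}
    {R₀ : X → EuclideanSpace ℝ (Fin 3) →L[ℝ] EuclideanSpace ℝ (Fin 3)}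
    (hR : ∀ k i, MemLp (fun x => R k x (stdOrthonormalBasis ℝ (EuclideanSpace ℝ (Fin 3)) i)) 2 μ)
    (hR₀ : ∀ i, MemLp (fun x => R₀ x (stdOrthonormalBasis ℝ (EuclideanSpace ℝ (Fin 3)) i)) 2 μ)
    (hRl : ∀ i, Tendsto (fun k => eLpNorm ((fun x => R k x (stdOrthonormalBasis ℝ (EuclideanSpace ℝ (Fin 3)) i)) -
      fun x => R₀ x (stdOrthonormalBasis ℝ (EuclideanSpace ℝ (Fin 3)) i)) 2 μ) atTop (𝓝 0))
    (hΓ₀ : ∀ i, MemLp (fun x => Γ₀ x (stdOrthonormalBasis ℝ (EuclideanSpace ℝ (Fin 3)) i)) 2 μ) :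
    Tendsto (fun k => ∫ x, frobeniusInner (Γ k x) (R k x) ∂μ) atTop (𝓝 (∫ x, frobeniusInner (Γ₀ x) (R₀ x) ∂μ)) := by
  have hΓmem : ∀ k i, MemLp (fun x => Γ k x (stdOrthonormalBasis ℝ (EuclideanSpace ℝ (Fin 3)) i)) 2 μ :=
    fun k i => ⟨hΓm k i, (hΓb k i).trans_lt hM.lt_top⟩
  have hint : ∀ {a b : X → EuclideanSpace ℝ (Fin 3)}, MemLp a 2 μ → MemLp b 2 μ → Integrable (fun x => ⟪a x, b x⟫) μ :=
    fun {a b} ha hb => (ha.norm.integrable_mul hb.norm).mono' (ha.1.inner hb.1) (Eventually.of_forall fun x => norm_inner_le_norm _ _)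
  have hsum : ∀ k, ∫ x, frobeniusInner (Γ k x) (R k x) ∂μ =
      ∑ i, ∫ x, ⟪Γ k x (stdOrthonormalBasis ℝ (EuclideanSpace ℝ (Fin 3)) i), R k x (stdOrthonormalBasis ℝ (EuclideanSpace ℝ (Fin 3)) i)⟫ ∂μ := by
    intro k
    simp only [frobeniusInner]
    exact integral_finsetSum _ fun i _ => hint (hΓmem k i) (hR k i)
  have hsum₀ : ∫ x, frobeniusInner (Γ₀ x) (R₀ x) ∂μ =
      ∑ i, ∫ x, ⟪Γ₀ x (stdOrthonormalBasis ℝ (EuclideanSpace ℝ (Fin 3)) i), R₀ x (stdOrthonormalBasis ℝ (EuclideanSpace ℝ (Fin 3)) i)⟫ ∂μ := by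
    simp only [frobeniusInner]
    exact integral_finsetSum _ fun i _ => hint (hΓ₀ i) (hR₀ i)
  simp only [hsum, hsum₀]
  refine tendsto_finsetSum _ fun i _ => ?_
  exact tendsto_integral_inner_weak_strong (fun k => hΓm k i) hM (fun k => hΓb k i) (hw i) (fun k => hR k i) (hR₀ i) (hRl i)

end Frobenius

/-! ### The weak formulation in the limit -/

section WeakFormLimit

set_option maxHeartbeats 800000 in
/-- **The weak formulation (2.2) passes to the limit** ([BT1], proof of Thm 2.4 with Def. 2.2).
Along `T`-periodic weak solutions `(U_k, p_k)` with weak gradients `G_k = ∇U_k` of the mollified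
perturbed Leray systems at scales `ε_k > 0` around the `C¹` `T`-periodic profile `W`
(`IsMollifiedPeriodicWeakSolution`, weak form (iii)), with `U_k → U` in `L²` of the cylinders,
`η_{ε_k} * U_k → U` in `L³` of the cylinders and `∇U_k ⇀ ∇U` weakly in `L²` of the slabs, the
limit `u = U + W`, `∇u = ∇U + ∇W` satisfies the weak form (2.2) against `𝒟_T` integrated over a
period: `∫₀ᵀ ∫ (⟪u, ∂ₛf⟫ − ∇u:∇f + ⟪u + (y·∇)u − (u·∇)u, f⟫) dy ds = 0`. Every piece of the
approximate identity passes to the limit on `(0,T) × B(0,R_f)` (strong × bounded; the Frobenius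
pairings `∇U_k : R_k` with `R_k → R` strongly, `tendsto_integral_frobeniusInner`; the term
`⟪f, DW U_k⟫`), and `⟨LW(s), f(s)⟩` plus the `W`-terms is `d/ds ∫⟪W, f⟫`, whose integral over a
period vanishes (`integral_Ioo_deriv_pairing_eq_zero`). [cite: BradshawTsai2017AHP, proof of Thm 2.4 with Def. 2.2 (2.2)] -/
theorem weakForm_limit {T : ℝ} (hT : 0 < T)
    {W : ℝ → EuclideanSpace ℝ (Fin 3) → EuclideanSpace ℝ (Fin 3)} (hW : ContDiff ℝ 1 (uncurry W))
    (hWper : ∀ s y, W (s + T) y = W s y)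
    {η : EuclideanSpace ℝ (Fin 3) → ℝ} (hη : IsMollifyingKernel η) {C : ℝ≥0} {ε : ℕ → ℝ} (hε : ∀ k, 0 < ε k)
    {U : ℕ → ℝ → EuclideanSpace ℝ (Fin 3) → EuclideanSpace ℝ (Fin 3)} {p : ℕ → ℝ → EuclideanSpace ℝ (Fin 3) → ℝ}
    (hsol : ∀ k, IsMollifiedPeriodicWeakSolution T W η (ε k) C (U k) (p k))
    {G : ℕ → ℝ → EuclideanSpace ℝ (Fin 3) → EuclideanSpace ℝ (Fin 3) →L[ℝ] EuclideanSpace ℝ (Fin 3)}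
    (hGg : ∀ k, HasWeakSpatialGradientOn (⊤ : Opens (ℝ × EuclideanSpace ℝ (Fin 3))) (U k) (G k))
    (hGb : ∀ k, ∫⁻ z in Ioo 0 T ×ˢ (univ : Set (EuclideanSpace ℝ (Fin 3))),
      ENNReal.ofReal (frobeniusNormSq (G k z.1 z.2)) ≤ C)
    (hGiii : ∀ k (f : ℝ → EuclideanSpace ℝ (Fin 3) → EuclideanSpace ℝ (Fin 3)), IsPeriodicDivFreeTest T f →
      ∫ s in Ioo 0 T, ((∫ y, (⟪U k s y, timeDeriv f s y⟫ -
          frobeniusInner (G k s y) (fderiv ℝ (f s) y) +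
          ⟪U k s y + G k s y y - G k s y (W s y + mollify η (ε k) (U k) s y) -
            fderiv ℝ (W s) y (U k s y) - fderiv ℝ (W s) y (W s y), f s y⟫)) -
        lerayPairing W s (f s)) = 0)
    {Ul : ℝ → EuclideanSpace ℝ (Fin 3) → EuclideanSpace ℝ (Fin 3)}
    (hUlm : AEStronglyMeasurable (uncurry Ul) (volume : Measure (ℝ × EuclideanSpace ℝ (Fin 3))))
    (hconv : ∀ n : ℕ, Tendsto (fun k => ∫⁻ z in Ioo (-((n : ℝ) + 1)) ((n : ℝ) + 1) ×ˢ
        ball (0 : EuclideanSpace ℝ (Fin 3)) (n + 1), ‖U k z.1 z.2 - Ul z.1 z.2‖ₑ ^ 2) atTop (𝓝 0))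
    (hmoll : ∀ a b R : ℝ, Tendsto (fun k => eLpNorm (fun z : ℝ × EuclideanSpace ℝ (Fin 3) =>
        mollify η (ε k) (U k) z.1 z.2 - Ul z.1 z.2) 3
        (volume.restrict (Ioo a b ×ˢ ball (0 : EuclideanSpace ℝ (Fin 3)) R))) atTop (𝓝 0))
    {Gu : ℝ → EuclideanSpace ℝ (Fin 3) → EuclideanSpace ℝ (Fin 3) →L[ℝ] EuclideanSpace ℝ (Fin 3)}
    (hGu : HasWeakSpatialGradientOn (⊤ : Opens (ℝ × EuclideanSpace ℝ (Fin 3))) Ul Gu)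
    (hGub : ∀ m : ℕ, ∫⁻ z in Ioo (-((m : ℝ) + 1)) ((m : ℝ) + 1) ×ˢ (univ : Set (EuclideanSpace ℝ (Fin 3))),
      ENNReal.ofReal (frobeniusNormSq (Gu z.1 z.2)) < ∞)
    (hGw : ∀ (m : ℕ) (a : EuclideanSpace ℝ (Fin 3)) (h : ℝ × EuclideanSpace ℝ (Fin 3) → EuclideanSpace ℝ (Fin 3)),
      MemLp h 2 (volume.restrict (Ioo (-((m : ℝ) + 1)) ((m : ℝ) + 1) ×ˢ (univ : Set (EuclideanSpace ℝ (Fin 3))))) →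
      Tendsto (fun k => ∫ z in Ioo (-((m : ℝ) + 1)) ((m : ℝ) + 1) ×ˢ (univ : Set (EuclideanSpace ℝ (Fin 3))),
          ⟪G k z.1 z.2 a, h z⟫) atTop
        (𝓝 (∫ z in Ioo (-((m : ℝ) + 1)) ((m : ℝ) + 1) ×ˢ (univ : Set (EuclideanSpace ℝ (Fin 3))), ⟪Gu z.1 z.2 a, h z⟫)))
    (f : ℝ → EuclideanSpace ℝ (Fin 3) → EuclideanSpace ℝ (Fin 3)) (hf : IsPeriodicDivFreeTest T f) :
    ∫ s in Ioo 0 T, ∫ y, (⟪Ul s y + W s y, timeDeriv f s y⟫ -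
        frobeniusInner (Gu s y + fderiv ℝ (W s) y) (fderiv ℝ (f s) y) +
        ⟪Ul s y + W s y + (Gu s y + fderiv ℝ (W s) y) y - (Gu s y + fderiv ℝ (W s) y) (Ul s y + W s y), f s y⟫) = 0 := by
  have happ : Continuous (uncurry fun (L : EuclideanSpace ℝ (Fin 3) →L[ℝ] EuclideanSpace ℝ (Fin 3)) (v : EuclideanSpace ℝ (Fin 3)) => L v) :=
    isBoundedBilinearMap_apply.continuous
  -- ## the test field: support, continuity, periodicity and bounds of the weights
  have hf1 : ContDiff ℝ 1 (uncurry f) := hf.contDiff.of_le (by exact_mod_cast le_top)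
  obtain ⟨Rf, hRf0, hRf⟩ := hf.exists_ball
  have cf : Continuous fun z : ℝ × EuclideanSpace ℝ (Fin 3) => f z.1 z.2 := hf1.continuous
  have cft : Continuous fun z : ℝ × EuclideanSpace ℝ (Fin 3) => timeDeriv f z.1 z.2 := continuous_timeDeriv_of_contDiff_one hf1
  have cDf : Continuous fun z : ℝ × EuclideanSpace ℝ (Fin 3) => fderiv ℝ (f z.1) z.2 := continuous_fderiv_slice_of_contDiff hf1
  have hftper : ∀ s y, timeDeriv f (s + T) y = timeDeriv f s y := by
    intro s y
    have h := deriv_comp_add_const (f := fun τ => f τ y) (a := T) (x := s)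
    simp only [hf.periodic] at h
    rw [timeDeriv, timeDeriv]
    exact h.symm
  have hDfper : ∀ s y, fderiv ℝ (f (s + T)) y = fderiv ℝ (f s) y := by
    intro s y; rw [show f (s + T) = f s from funext (hf.periodic s)]
  obtain ⟨Cf, hCf0, hCf⟩ := exists_global_bound_of_periodic cf hT (fun s y => hf.periodic s y)
    (fun z hz => (hRf z.1 z.2 hz).1)
  obtain ⟨Cft, hCft0, hCft⟩ := exists_global_bound_of_periodic cft hT hftper (fun z hz => (hRf z.1 z.2 hz).2.2)
  obtain ⟨CDf, hCDf0, hCDf⟩ := exists_global_bound_of_periodic cDf hT hDfper (fun z hz => (hRf z.1 z.2 hz).2.1)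
  -- ## the cylinder `(0,T) × B(0,R_f)` and the comparison cylinders
  set I : Set ℝ := Ioo 0 T with hI
  set B : Set (EuclideanSpace ℝ (Fin 3)) := ball (0 : EuclideanSpace ℝ (Fin 3)) Rf with hB
  set S : Set (ℝ × EuclideanSpace ℝ (Fin 3)) := I ×ˢ B with hS
  have hSm : MeasurableSet S := measurableSet_Ioo.prod measurableSet_ball
  haveI hfinQ : IsFiniteMeasure (volume.restrict S) :=
    NSCylinder.isFiniteMeasure_restrict (Ω := ⟨ball (0 : EuclideanSpace ℝ (Fin 3)) Rf, isOpen_ball⟩) isBounded_ball 0 T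
  set μQ : Measure (ℝ × EuclideanSpace ℝ (Fin 3)) := volume.restrict S with hμQ
  set n : ℕ := ⌈max T Rf⌉₊ with hn
  have hTn : T ≤ (n : ℝ) + 1 := ((le_max_left T Rf).trans (Nat.le_ceil _)).trans (le_add_of_nonneg_right zero_le_one)
  have hRn : Rf ≤ (n : ℝ) + 1 := ((le_max_right T Rf).trans (Nat.le_ceil _)).trans (le_add_of_nonneg_right zero_le_one)
  have hSQ : S ⊆ Ioo (-((n : ℝ) + 1)) ((n : ℝ) + 1) ×ˢ ball (0 : EuclideanSpace ℝ (Fin 3)) (n + 1) := fun z hz =>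
    ⟨⟨by linarith [hz.1.1, (Nat.cast_nonneg n : (0 : ℝ) ≤ n)], hz.1.2.trans_le hTn⟩, ball_subset_ball hRn hz.2⟩
  have hSslab : S ⊆ Ioo (-((n : ℝ) + 1)) ((n : ℝ) + 1) ×ˢ (univ : Set (EuclideanSpace ℝ (Fin 3))) := fun z hz =>
    ⟨(hSQ hz).1, mem_univ _⟩
  -- ## the profile on the cylinder
  obtain ⟨M, hM0, hMW, -⟩ := exists_profile_bound hW 0 T (0 : EuclideanSpace ℝ (Fin 3)) Rf
  have hWc : Continuous (uncurry W) := hW.continuous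
  have cW : Continuous fun z : ℝ × EuclideanSpace ℝ (Fin 3) => W z.1 z.2 := hWc
  have cDW : Continuous fun z : ℝ × EuclideanSpace ℝ (Fin 3) => fderiv ℝ (W z.1) z.2 := continuous_fderiv_slice_of_contDiff hW
  obtain ⟨M₂, hM₂⟩ := ((isCompact_Icc (a := (0 : ℝ)) (b := T)).prod
    (isCompact_closedBall (0 : EuclideanSpace ℝ (Fin 3)) Rf)).exists_bound_of_continuousOn cDW.continuousOn
  set MD : ℝ := max M₂ 0 with hMD
  have hMD0 : 0 ≤ MD := le_max_right _ _
  have hMDW : ∀ s ∈ Icc 0 T, ∀ y ∈ closedBall (0 : EuclideanSpace ℝ (Fin 3)) Rf, ‖fderiv ℝ (W s) y‖ ≤ MD :=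
    fun s hs y hy => (hM₂ (s, y) ⟨hs, hy⟩).trans (le_max_left _ _)
  have hWm : AEStronglyMeasurable (fun z : ℝ × EuclideanSpace ℝ (Fin 3) => W z.1 z.2) μQ := cW.aestronglyMeasurable.restrict
  have hWbd : ∀ᵐ z ∂μQ, ‖W z.1 z.2‖ ≤ M := by
    filter_upwards [ae_restrict_mem hSm] with z hz
    exact hMW z.1 (Ioo_subset_Icc_self hz.1) z.2 (ball_subset_closedBall hz.2)
  have hWmem : MemLp (fun z : ℝ × EuclideanSpace ℝ (Fin 3) => W z.1 z.2) 2 μQ := (memLp_top_of_bound hWm M hWbd).mono_exponent le_top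
  -- the truncated slice derivative of the profile (bounded everywhere)
  set L : ℝ × EuclideanSpace ℝ (Fin 3) → EuclideanSpace ℝ (Fin 3) →L[ℝ] EuclideanSpace ℝ (Fin 3) :=
    S.indicator fun z => fderiv ℝ (W z.1) z.2 with hL
  have hLm : AEStronglyMeasurable L μQ := (cDW.aestronglyMeasurable.indicator hSm).restrict
  have hLM : ∀ z, ‖L z‖ ≤ MD := by
    intro z
    by_cases hz : z ∈ S
    · rw [hL, indicator_of_mem hz]
      exact hMDW z.1 (Ioo_subset_Icc_self hz.1) z.2 (ball_subset_closedBall hz.2)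
    · rw [hL, indicator_of_notMem hz, norm_zero]; exact hMD0
  have hLae : ∀ᵐ z ∂μQ, L z = fderiv ℝ (W z.1) z.2 := by
    filter_upwards [ae_restrict_mem hSm] with z hz
    rw [hL, indicator_of_mem hz]
  -- ## classes and convergences of the velocities on the cylinder
  have hUm : ∀ k, AEStronglyMeasurable (uncurry (U k)) (volume : Measure (ℝ × EuclideanSpace ℝ (Fin 3))) :=
    fun k => (hsol k).aestronglyMeasurable_velocity
  have hUmem : ∀ k, MemLp (fun z : ℝ × EuclideanSpace ℝ (Fin 3) => U k z.1 z.2) 2 μQ := fun k =>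
    ((hsol k).cylinder_classes hWc hη (hε k) hMW).1
  have hmmem : ∀ k, MemLp (fun z : ℝ × EuclideanSpace ℝ (Fin 3) => mollify η (ε k) (U k) z.1 z.2) 2 μQ := fun k =>
    ((hsol k).cylinder_classes hWc hη (hε k) hMW).2.2.2
  obtain ⟨hUlQ, -⟩ := locallyIntegrable_of_cylinder_limit (V := U) hUm
    (fun k m => ((hsol k).lintegral_cylinder_sq_le _ _ 0 _).trans_lt
      (ENNReal.mul_lt_top ENNReal.ofReal_lt_top ENNReal.coe_lt_top)) hUlm hconv
  have hUlmem : MemLp (fun z : ℝ × EuclideanSpace ℝ (Fin 3) => Ul z.1 z.2) 2 μQ := by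
    refine ⟨hUlm.restrict, ?_⟩
    rw [FunctionSpaces.AubinLions.eLpNorm_two_eq_rpow]
    exact ENNReal.rpow_lt_top_of_nonneg (by norm_num) (((lintegral_mono_set hSQ).trans_lt (hUlQ n)).ne)
  have hbkmem : ∀ k, MemLp (fun z : ℝ × EuclideanSpace ℝ (Fin 3) => W z.1 z.2 + mollify η (ε k) (U k) z.1 z.2) 2 μQ :=
    fun k => hWmem.add (hmmem k)
  have hbmem : MemLp (fun z : ℝ × EuclideanSpace ℝ (Fin 3) => W z.1 z.2 + Ul z.1 z.2) 2 μQ := hWmem.add hUlmem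
  have hfmem : MemLp (fun z : ℝ × EuclideanSpace ℝ (Fin 3) => f z.1 z.2) 2 μQ :=
    (memLp_top_of_bound cf.aestronglyMeasurable.restrict Cf (Eventually.of_forall hCf)).mono_exponent le_top
  have hconvU : Tendsto (fun k => eLpNorm ((fun z : ℝ × EuclideanSpace ℝ (Fin 3) => U k z.1 z.2) - fun z => Ul z.1 z.2) 2 μQ)
      atTop (𝓝 0) := by
    refine FunctionSpaces.tendsto_eLpNorm_two_of_tendsto_lintegral_sq (f := fun k => uncurry (U k)) (g := uncurry Ul) ?_
    exact tendsto_of_tendsto_of_tendsto_of_le_of_le tendsto_const_nhds (hconv n) (fun _ => zero_le)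
      fun k => lintegral_mono_set hSQ
  have hconvm : Tendsto (fun k => eLpNorm ((fun z : ℝ × EuclideanSpace ℝ (Fin 3) => mollify η (ε k) (U k) z.1 z.2) -
      fun z => Ul z.1 z.2) 2 μQ) atTop (𝓝 0) :=
    tendsto_eLpNorm_two_of_three (fun k => (hmmem k).1.sub hUlmem.1) (hmoll 0 T Rf)
  have hconvb : Tendsto (fun k => eLpNorm ((fun z : ℝ × EuclideanSpace ℝ (Fin 3) => W z.1 z.2 + mollify η (ε k) (U k) z.1 z.2) -
      fun z => W z.1 z.2 + Ul z.1 z.2) 2 μQ) atTop (𝓝 0) := by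
    refine hconvm.congr fun k => ?_
    congr 1; funext z; simp only [Pi.sub_apply]; abel
  have hconvf : Tendsto (fun _ : ℕ => eLpNorm ((fun z : ℝ × EuclideanSpace ℝ (Fin 3) => f z.1 z.2) -
      fun z => f z.1 z.2) 2 μQ) atTop (𝓝 0) := by
    simp only [sub_self, eLpNorm_zero]; exact tendsto_const_nhds
  -- ## the gradients on the cylinder: columns, bounds, weak convergence
  have hGm : ∀ k, AEStronglyMeasurable (fun z : ℝ × EuclideanSpace ℝ (Fin 3) => G k z.1 z.2)
      (volume : Measure (ℝ × EuclideanSpace ℝ (Fin 3))) := by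
    intro k
    have h1 := (hGg k).locallyIntegrableOn_grad.aestronglyMeasurable
    rwa [Opens.coe_top, Measure.restrict_univ] at h1
  have hGum : AEStronglyMeasurable (fun z : ℝ × EuclideanSpace ℝ (Fin 3) => Gu z.1 z.2)
      (volume : Measure (ℝ × EuclideanSpace ℝ (Fin 3))) := by
    have h1 := hGu.locallyIntegrableOn_grad.aestronglyMeasurable
    rwa [Opens.coe_top, Measure.restrict_univ] at h1
  have hcolm : ∀ {Γ : ℝ × EuclideanSpace ℝ (Fin 3) → EuclideanSpace ℝ (Fin 3) →L[ℝ] EuclideanSpace ℝ (Fin 3)},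
      AEStronglyMeasurable Γ (volume : Measure (ℝ × EuclideanSpace ℝ (Fin 3))) → ∀ a : EuclideanSpace ℝ (Fin 3),
      AEStronglyMeasurable (fun z => Γ z a) μQ := fun hΓ a =>
    (happ.comp_aestronglyMeasurable₂ hΓ aestronglyMeasurable_const).restrict
  -- `∫_S ‖Γ eᵢ‖² ≤ ∫_S' |Γ|²_F` for `S ⊆ S'`
  have hcol2 : ∀ {Γ : ℝ × EuclideanSpace ℝ (Fin 3) → EuclideanSpace ℝ (Fin 3) →L[ℝ] EuclideanSpace ℝ (Fin 3)}
      {S' : Set (ℝ × EuclideanSpace ℝ (Fin 3))}, S ⊆ S' → ∀ i,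
      eLpNorm (fun z => Γ z (stdOrthonormalBasis ℝ (EuclideanSpace ℝ (Fin 3)) i)) 2 μQ ≤
        (∫⁻ z in S', ENNReal.ofReal (frobeniusNormSq (Γ z))) ^ (1 / 2 : ℝ) := by
    intro Γ S' hSS' i
    rw [FunctionSpaces.AubinLions.eLpNorm_two_eq_rpow]
    refine ENNReal.rpow_le_rpow ((lintegral_mono fun z => ?_).trans (lintegral_mono_set hSS')) (by norm_num)
    rw [← ofReal_norm, ← ENNReal.ofReal_pow (norm_nonneg _)]
    exact ENNReal.ofReal_le_ofReal (norm_apply_basis_sq_le_frobeniusNormSq _ _)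
  have hGcol : ∀ k i, eLpNorm (fun z : ℝ × EuclideanSpace ℝ (Fin 3) => G k z.1 z.2 (stdOrthonormalBasis ℝ (EuclideanSpace ℝ (Fin 3)) i)) 2 μQ ≤
      (C : ℝ≥0∞) ^ (1 / 2 : ℝ) := fun k i =>
    (hcol2 (Γ := fun z => G k z.1 z.2) (prod_mono Subset.rfl (subset_univ _)) i).trans
      (ENNReal.rpow_le_rpow (hGb k) (by norm_num))
  have hCtop : (C : ℝ≥0∞) ^ (1 / 2 : ℝ) ≠ ⊤ := ENNReal.rpow_ne_top_of_nonneg (by norm_num) ENNReal.coe_ne_top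
  have hGumem : ∀ i, MemLp (fun z : ℝ × EuclideanSpace ℝ (Fin 3) => Gu z.1 z.2 (stdOrthonormalBasis ℝ (EuclideanSpace ℝ (Fin 3)) i)) 2 μQ :=
    fun i => ⟨hcolm hGum _, (hcol2 (Γ := fun z => Gu z.1 z.2) hSslab i).trans_lt
      (ENNReal.rpow_lt_top_of_nonneg (by norm_num) (hGub n).ne)⟩
  have hGkmem : ∀ k i, MemLp (fun z : ℝ × EuclideanSpace ℝ (Fin 3) => G k z.1 z.2 (stdOrthonormalBasis ℝ (EuclideanSpace ℝ (Fin 3)) i)) 2 μQ :=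
    fun k i => ⟨hcolm (hGm k) _, (hGcol k i).trans_lt hCtop.lt_top⟩
  -- weak convergence of the columns on the cylinder
  have hGwQ : ∀ (a : EuclideanSpace ℝ (Fin 3)) (h : ℝ × EuclideanSpace ℝ (Fin 3) → EuclideanSpace ℝ (Fin 3)), MemLp h 2 μQ →
      Tendsto (fun k => ∫ z, ⟪G k z.1 z.2 a, h z⟫ ∂μQ) atTop (𝓝 (∫ z, ⟪Gu z.1 z.2 a, h z⟫ ∂μQ)) := by
    intro a h hh
    set S' : Set (ℝ × EuclideanSpace ℝ (Fin 3)) := Ioo (-((n : ℝ) + 1)) ((n : ℝ) + 1) ×ˢ (univ : Set (EuclideanSpace ℝ (Fin 3))) with hS'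
    have hS'm : MeasurableSet S' := measurableSet_Ioo.prod MeasurableSet.univ
    have hres : (volume.restrict S').restrict S = μQ := by
      rw [Measure.restrict_restrict hSm, inter_eq_left.2 hSslab]
    have hh' : MemLp (S.indicator h) 2 (volume.restrict S') := by
      rw [memLp_indicator_iff_restrict hSm, hres]; exact hh
    have hind : ∀ (Γ : ℝ × EuclideanSpace ℝ (Fin 3) → EuclideanSpace ℝ (Fin 3) →L[ℝ] EuclideanSpace ℝ (Fin 3)),
        ∫ z in S', ⟪Γ z a, S.indicator h z⟫ = ∫ z, ⟪Γ z a, h z⟫ ∂μQ := by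
      intro Γ
      have h1 : (fun z => ⟪Γ z a, S.indicator h z⟫) = S.indicator fun z => ⟪Γ z a, h z⟫ := by
        funext z
        by_cases hz : z ∈ S
        · rw [indicator_of_mem hz, indicator_of_mem hz]
        · rw [indicator_of_notMem hz, indicator_of_notMem hz, inner_zero_right]
      rw [h1, setIntegral_indicator hSm, inter_eq_right.2 hSslab]
    have h := hGw n a (S.indicator h) hh'
    rw [← hS'] at h
    simp only [hind] at h
    exact h
  -- ## the seven pieces of the tested integrand on the cylinder, for data `(w, Γ, b)`
  have hwt : AEStronglyMeasurable (fun z : ℝ × EuclideanSpace ℝ (Fin 3) => timeDeriv f z.1 z.2) μQ := cft.aestronglyMeasurable.restrict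
  have hwf : AEStronglyMeasurable (fun z : ℝ × EuclideanSpace ℝ (Fin 3) => f z.1 z.2) μQ := cf.aestronglyMeasurable.restrict
  have hwD : AEStronglyMeasurable (fun z : ℝ × EuclideanSpace ℝ (Fin 3) => fderiv ℝ (f z.1) z.2) μQ := cDf.aestronglyMeasurable.restrict
  have he1 : ∀ i, ‖stdOrthonormalBasis ℝ (EuclideanSpace ℝ (Fin 3)) i‖ = 1 := fun i =>
    (stdOrthonormalBasis ℝ (EuclideanSpace ℝ (Fin 3))).orthonormal.1 i
  -- generic integrability facts
  have hinner : ∀ {a c : ℝ × EuclideanSpace ℝ (Fin 3) → EuclideanSpace ℝ (Fin 3)}, MemLp a 2 μQ → MemLp c 2 μQ →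
      Integrable (fun z => ⟪a z, c z⟫) μQ := fun {a c} ha hc =>
    (ha.norm.integrable_mul hc.norm).mono' (ha.1.inner hc.1) (Eventually.of_forall fun z => norm_inner_le_norm _ _)
  have hbdmem : ∀ {c : ℝ × EuclideanSpace ℝ (Fin 3) → EuclideanSpace ℝ (Fin 3)} {K : ℝ}, AEStronglyMeasurable c μQ →
      (∀ᵐ z ∂μQ, ‖c z‖ ≤ K) → MemLp c 2 μQ := fun {c K} hc hK => (memLp_top_of_bound hc K hK).mono_exponent le_top
  have hLmem : ∀ {a : ℝ × EuclideanSpace ℝ (Fin 3) → EuclideanSpace ℝ (Fin 3)}, MemLp a 2 μQ → MemLp (fun z => L z (a z)) 2 μQ :=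
    fun {a} ha => MemLp.of_le_mul (c := MD) ha (happ.comp_aestronglyMeasurable₂ hLm ha.1)
      (Eventually.of_forall fun z => (ContinuousLinearMap.le_opNorm _ _).trans (mul_le_mul_of_nonneg_right (hLM z) (norm_nonneg _)))
  -- the columns of the three partner fields
  have hRDf : ∀ i, MemLp (fun z : ℝ × EuclideanSpace ℝ (Fin 3) => fderiv ℝ (f z.1) z.2 (stdOrthonormalBasis ℝ (EuclideanSpace ℝ (Fin 3)) i)) 2 μQ :=
    fun i => hbdmem ((happ.comp_aestronglyMeasurable₂ hwD aestronglyMeasurable_const)) (Eventually.of_forall fun z =>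
      ((ContinuousLinearMap.le_opNorm _ _).trans (by rw [he1, mul_one]; exact hCDf z)))
  have hRy : ∀ i, MemLp (fun z : ℝ × EuclideanSpace ℝ (Fin 3) =>
      ((innerSL ℝ z.2).smulRight (f z.1 z.2)) (stdOrthonormalBasis ℝ (EuclideanSpace ℝ (Fin 3)) i)) 2 μQ := by
    intro i
    simp only [ContinuousLinearMap.smulRight_apply, innerSL_apply_apply]
    have hc : Continuous fun z : ℝ × EuclideanSpace ℝ (Fin 3) =>
        ⟪z.2, stdOrthonormalBasis ℝ (EuclideanSpace ℝ (Fin 3)) i⟫ • f z.1 z.2 :=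
      (continuous_snd.inner (𝕜 := ℝ) (continuous_const (y := stdOrthonormalBasis ℝ (EuclideanSpace ℝ (Fin 3)) i))).smul cf
    refine hbdmem hc.aestronglyMeasurable.restrict (K := Rf * Cf) ?_
    filter_upwards [ae_restrict_mem hSm] with z hz
    rw [norm_smul]
    refine mul_le_mul ?_ (hCf z) (norm_nonneg _) hRf0.le
    calc ‖⟪z.2, stdOrthonormalBasis ℝ (EuclideanSpace ℝ (Fin 3)) i⟫‖ ≤ ‖z.2‖ * ‖stdOrthonormalBasis ℝ (EuclideanSpace ℝ (Fin 3)) i‖ :=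
          norm_inner_le_norm _ _
      _ ≤ Rf := by rw [he1, mul_one]; exact (mem_ball_zero_iff.1 hz.2).le
  have hRb : ∀ {b : ℝ × EuclideanSpace ℝ (Fin 3) → EuclideanSpace ℝ (Fin 3)}, MemLp b 2 μQ → ∀ i,
      MemLp (fun z : ℝ × EuclideanSpace ℝ (Fin 3) =>
        ((innerSL ℝ (b z)).smulRight (f z.1 z.2)) (stdOrthonormalBasis ℝ (EuclideanSpace ℝ (Fin 3)) i)) 2 μQ := by
    intro b hb i
    simp only [ContinuousLinearMap.smulRight_apply, innerSL_apply_apply]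
    have hm : AEStronglyMeasurable (fun z : ℝ × EuclideanSpace ℝ (Fin 3) =>
        ⟪b z, stdOrthonormalBasis ℝ (EuclideanSpace ℝ (Fin 3)) i⟫ • f z.1 z.2) μQ :=
      (hb.1.inner (𝕜 := ℝ) (aestronglyMeasurable_const (b := stdOrthonormalBasis ℝ (EuclideanSpace ℝ (Fin 3)) i))).smul hwf
    refine MemLp.of_le_mul (c := Cf) hb hm (Eventually.of_forall fun z => ?_)
    rw [norm_smul]
    calc ‖⟪b z, stdOrthonormalBasis ℝ (EuclideanSpace ℝ (Fin 3)) i⟫‖ * ‖f z.1 z.2‖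
        ≤ (‖b z‖ * ‖stdOrthonormalBasis ℝ (EuclideanSpace ℝ (Fin 3)) i‖) * Cf :=
          mul_le_mul (norm_inner_le_norm _ _) (hCf z) (norm_nonneg _) (by positivity)
      _ = Cf * ‖b z‖ := by rw [he1, mul_one, mul_comm]
  -- ## the split of the tested integrand into seven integrals
  have hsplit : ∀ {w b : ℝ × EuclideanSpace ℝ (Fin 3) → EuclideanSpace ℝ (Fin 3)}
      {Γ : ℝ × EuclideanSpace ℝ (Fin 3) → EuclideanSpace ℝ (Fin 3) →L[ℝ] EuclideanSpace ℝ (Fin 3)},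
      MemLp w 2 μQ → MemLp b 2 μQ →
      (∀ i, MemLp (fun z => Γ z (stdOrthonormalBasis ℝ (EuclideanSpace ℝ (Fin 3)) i)) 2 μQ) →
      Integrable (fun z => ⟪w z, timeDeriv f z.1 z.2⟫ - frobeniusInner (Γ z) (fderiv ℝ (f z.1) z.2) + ⟪w z, f z.1 z.2⟫ +
          frobeniusInner (Γ z) ((innerSL ℝ z.2).smulRight (f z.1 z.2)) -
          frobeniusInner (Γ z) ((innerSL ℝ (b z)).smulRight (f z.1 z.2)) - ⟪f z.1 z.2, L z (w z)⟫ -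
          ⟪L z (W z.1 z.2), f z.1 z.2⟫) μQ ∧
      ∫ z, (⟪w z, timeDeriv f z.1 z.2⟫ - frobeniusInner (Γ z) (fderiv ℝ (f z.1) z.2) + ⟪w z, f z.1 z.2⟫ +
          frobeniusInner (Γ z) ((innerSL ℝ z.2).smulRight (f z.1 z.2)) -
          frobeniusInner (Γ z) ((innerSL ℝ (b z)).smulRight (f z.1 z.2)) - ⟪f z.1 z.2, L z (w z)⟫ -
          ⟪L z (W z.1 z.2), f z.1 z.2⟫) ∂μQ =
        (∫ z, ⟪w z, timeDeriv f z.1 z.2⟫ ∂μQ) - (∫ z, frobeniusInner (Γ z) (fderiv ℝ (f z.1) z.2) ∂μQ) +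
          (∫ z, ⟪w z, f z.1 z.2⟫ ∂μQ) + (∫ z, frobeniusInner (Γ z) ((innerSL ℝ z.2).smulRight (f z.1 z.2)) ∂μQ) -
          (∫ z, frobeniusInner (Γ z) ((innerSL ℝ (b z)).smulRight (f z.1 z.2)) ∂μQ) -
          (∫ z, ⟪f z.1 z.2, L z (w z)⟫ ∂μQ) - ∫ z, ⟪L z (W z.1 z.2), f z.1 z.2⟫ ∂μQ := by
    intro w b Γ hw hb hΓ
    have i1 : Integrable (fun z => ⟪w z, timeDeriv f z.1 z.2⟫) μQ := hinner hw (hbdmem hwt (Eventually.of_forall hCft))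
    have i2 : Integrable (fun z => frobeniusInner (Γ z) (fderiv ℝ (f z.1) z.2)) μQ :=
      integrable_frobeniusInner_of_columns (μ := μQ) (Γ := Γ) (R := fun z : ℝ × EuclideanSpace ℝ (Fin 3) => fderiv ℝ (f z.1) z.2) hΓ hRDf
    have i3 : Integrable (fun z => ⟪w z, f z.1 z.2⟫) μQ := hinner hw hfmem
    have i4 : Integrable (fun z => frobeniusInner (Γ z) ((innerSL ℝ z.2).smulRight (f z.1 z.2))) μQ :=
      integrable_frobeniusInner_of_columns (μ := μQ) (Γ := Γ) (R := fun z : ℝ × EuclideanSpace ℝ (Fin 3) => (innerSL ℝ z.2).smulRight (f z.1 z.2)) hΓ hRy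
    have i5 : Integrable (fun z => frobeniusInner (Γ z) ((innerSL ℝ (b z)).smulRight (f z.1 z.2))) μQ :=
      integrable_frobeniusInner_of_columns (μ := μQ) (Γ := Γ) (R := fun z : ℝ × EuclideanSpace ℝ (Fin 3) => (innerSL ℝ (b z)).smulRight (f z.1 z.2)) hΓ (hRb hb)
    have i6 : Integrable (fun z => ⟪f z.1 z.2, L z (w z)⟫) μQ := hinner hfmem (hLmem hw)
    have i7 : Integrable (fun z => ⟪L z (W z.1 z.2), f z.1 z.2⟫) μQ := hinner (hLmem hWmem) hfmem
    have i12 : Integrable (fun z => ⟪w z, timeDeriv f z.1 z.2⟫ - frobeniusInner (Γ z) (fderiv ℝ (f z.1) z.2)) μQ := i1.sub i2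
    have i123 : Integrable (fun z => ⟪w z, timeDeriv f z.1 z.2⟫ - frobeniusInner (Γ z) (fderiv ℝ (f z.1) z.2) + ⟪w z, f z.1 z.2⟫) μQ :=
      i12.add i3
    have i1234 : Integrable (fun z => ⟪w z, timeDeriv f z.1 z.2⟫ - frobeniusInner (Γ z) (fderiv ℝ (f z.1) z.2) + ⟪w z, f z.1 z.2⟫ +
        frobeniusInner (Γ z) ((innerSL ℝ z.2).smulRight (f z.1 z.2))) μQ := i123.add i4
    have i12345 : Integrable (fun z => ⟪w z, timeDeriv f z.1 z.2⟫ - frobeniusInner (Γ z) (fderiv ℝ (f z.1) z.2) + ⟪w z, f z.1 z.2⟫ +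
        frobeniusInner (Γ z) ((innerSL ℝ z.2).smulRight (f z.1 z.2)) -
        frobeniusInner (Γ z) ((innerSL ℝ (b z)).smulRight (f z.1 z.2))) μQ := i1234.sub i5
    have i123456 : Integrable (fun z => ⟪w z, timeDeriv f z.1 z.2⟫ - frobeniusInner (Γ z) (fderiv ℝ (f z.1) z.2) + ⟪w z, f z.1 z.2⟫ +
        frobeniusInner (Γ z) ((innerSL ℝ z.2).smulRight (f z.1 z.2)) -
        frobeniusInner (Γ z) ((innerSL ℝ (b z)).smulRight (f z.1 z.2)) - ⟪f z.1 z.2, L z (w z)⟫) μQ := i12345.sub i6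
    refine ⟨i123456.sub i7, ?_⟩
    rw [integral_sub i123456 i7, integral_sub i12345 i6, integral_sub i1234 i5, integral_add i123 i4,
      integral_add i12 i3, integral_sub i1 i2]
  -- ## the original integrand and its rewriting on the cylinder
  have hrewrite : ∀ (w b : ℝ × EuclideanSpace ℝ (Fin 3) → EuclideanSpace ℝ (Fin 3))
      (Γ : ℝ × EuclideanSpace ℝ (Fin 3) → EuclideanSpace ℝ (Fin 3) →L[ℝ] EuclideanSpace ℝ (Fin 3)),
      (fun z : ℝ × EuclideanSpace ℝ (Fin 3) => ⟪w z, timeDeriv f z.1 z.2⟫ - frobeniusInner (Γ z) (fderiv ℝ (f z.1) z.2) +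
        ⟪w z + Γ z z.2 - Γ z (b z) - fderiv ℝ (W z.1) z.2 (w z) - fderiv ℝ (W z.1) z.2 (W z.1 z.2), f z.1 z.2⟫) =ᵐ[μQ]
      fun z => ⟪w z, timeDeriv f z.1 z.2⟫ - frobeniusInner (Γ z) (fderiv ℝ (f z.1) z.2) + ⟪w z, f z.1 z.2⟫ +
          frobeniusInner (Γ z) ((innerSL ℝ z.2).smulRight (f z.1 z.2)) -
          frobeniusInner (Γ z) ((innerSL ℝ (b z)).smulRight (f z.1 z.2)) - ⟪f z.1 z.2, L z (w z)⟫ -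
          ⟪L z (W z.1 z.2), f z.1 z.2⟫ := by
    intro w b Γ
    filter_upwards [hLae] with z hz
    rw [hz, ← inner_clm_apply_eq_frobeniusInner_smulRight, ← inner_clm_apply_eq_frobeniusInner_smulRight,
      real_inner_comm (fderiv ℝ (W z.1) z.2 (w z))]
    simp only [inner_sub_left, inner_add_left]
    ring
  -- vanishing of the original integrand off the ball
  have hvanish : ∀ (w b : ℝ × EuclideanSpace ℝ (Fin 3) → EuclideanSpace ℝ (Fin 3))
      (Γ : ℝ × EuclideanSpace ℝ (Fin 3) → EuclideanSpace ℝ (Fin 3) →L[ℝ] EuclideanSpace ℝ (Fin 3)) (z : ℝ × EuclideanSpace ℝ (Fin 3)),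
      z.2 ∉ B → ⟪w z, timeDeriv f z.1 z.2⟫ - frobeniusInner (Γ z) (fderiv ℝ (f z.1) z.2) +
        ⟪w z + Γ z z.2 - Γ z (b z) - fderiv ℝ (W z.1) z.2 (w z) - fderiv ℝ (W z.1) z.2 (W z.1 z.2), f z.1 z.2⟫ = 0 := by
    intro w b Γ z hz
    obtain ⟨h1, h2, h3⟩ := hRf z.1 z.2 hz
    rw [h1, h2, h3, inner_zero_right, inner_zero_right, frobeniusInner_zero_right]
    ring
  -- ## from the hypothesis to the cylinder: Fubini
  have hprodI : (volume.restrict (I ×ˢ (univ : Set (EuclideanSpace ℝ (Fin 3)))) : Measure (ℝ × EuclideanSpace ℝ (Fin 3))) =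
      ((volume : Measure ℝ).restrict I).prod (volume : Measure (EuclideanSpace ℝ (Fin 3))) := by
    rw [FunctionSpaces.AubinLions.volume_restrict_prod, Measure.restrict_univ]
  have hSsub : S ⊆ I ×ˢ (univ : Set (EuclideanSpace ℝ (Fin 3))) := prod_mono Subset.rfl (subset_univ _)
  have hIum : MeasurableSet (I ×ˢ (univ : Set (EuclideanSpace ℝ (Fin 3)))) := measurableSet_Ioo.prod MeasurableSet.univ
  -- for data with the original integrand integrable on the cylinder: `∫_I ∫_y O = ∫_S O`
  have hfubini : ∀ {O : ℝ → EuclideanSpace ℝ (Fin 3) → ℝ}, Integrable (fun z => O z.1 z.2) μQ →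
      (∀ z : ℝ × EuclideanSpace ℝ (Fin 3), z.2 ∉ B → O z.1 z.2 = 0) →
      Integrable (fun s => ∫ y, O s y) ((volume : Measure ℝ).restrict I) ∧
      (∀ᵐ s ∂((volume : Measure ℝ).restrict I), Integrable (O s) (volume : Measure (EuclideanSpace ℝ (Fin 3)))) ∧
      ∫ s in I, ∫ y, O s y = ∫ z, O z.1 z.2 ∂μQ := by
    intro O hO hOz
    have h1 : IntegrableOn (fun z : ℝ × EuclideanSpace ℝ (Fin 3) => O z.1 z.2) (I ×ˢ (univ : Set (EuclideanSpace ℝ (Fin 3)))) volume :=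
      IntegrableOn.of_forall_sdiff_eq_zero hO hIum fun z hz => hOz z fun h => hz.2 ⟨hz.1.1, h⟩
    have h2 : Integrable (uncurry O) (((volume : Measure ℝ).restrict I).prod (volume : Measure (EuclideanSpace ℝ (Fin 3)))) := by
      rw [← hprodI]; exact h1
    refine ⟨h2.integral_prod_left, h2.prod_right_ae, ?_⟩
    rw [integral_integral h2, ← hprodI]
    exact setIntegral_eq_of_subset_of_forall_sdiff_eq_zero hIum hSsub fun z hz => hOz z fun h => hz.2 ⟨hz.1.1, h⟩
  -- the profile pairing is integrable on `(0, T)`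
  have cWt : Continuous fun z : ℝ × EuclideanSpace ℝ (Fin 3) => timeDeriv W z.1 z.2 := continuous_timeDeriv_of_contDiff_one hW
  have cDWy : Continuous fun z : ℝ × EuclideanSpace ℝ (Fin 3) => fderiv ℝ (W z.1) z.2 z.2 := happ.comp (cDW.prodMk continuous_snd)
  have cfrob : Continuous fun z : ℝ × EuclideanSpace ℝ (Fin 3) => frobeniusInner (fderiv ℝ (W z.1) z.2) (fderiv ℝ (f z.1) z.2) := by
    simp only [frobeniusInner]
    refine continuous_finsetSum _ fun i _ => ?_
    exact (cDW.clm_apply continuous_const).inner (cDf.clm_apply continuous_const)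
  have hLp : IntegrableOn (fun s => lerayPairing W s (f s)) I (volume : Measure ℝ) := by
    have c₁ : Continuous fun z : ℝ × EuclideanSpace ℝ (Fin 3) =>
        ⟪timeDeriv W z.1 z.2 - W z.1 z.2 - fderiv ℝ (W z.1) z.2 z.2, f z.1 z.2⟫ +
          frobeniusInner (fderiv ℝ (W z.1) z.2) (fderiv ℝ (f z.1) z.2) := (((cWt.sub cW).sub cDWy).inner cf).add cfrob
    have hz₁ : ∀ z : ℝ × EuclideanSpace ℝ (Fin 3), z.2 ∉ B →
        ⟪timeDeriv W z.1 z.2 - W z.1 z.2 - fderiv ℝ (W z.1) z.2 z.2, f z.1 z.2⟫ +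
          frobeniusInner (fderiv ℝ (W z.1) z.2) (fderiv ℝ (f z.1) z.2) = 0 := by
      intro z hz
      obtain ⟨h1, h2, -⟩ := hRf z.1 z.2 hz
      rw [h1, h2, inner_zero_right, frobeniusInner_zero_right, add_zero]
    exact integrableOn_integral_slice c₁ hz₁ 0 T
  -- the `W`-terms are integrable on `(0, T)`
  have hΛ : IntegrableOn (fun s => ∫ y, (⟪W s y, timeDeriv f s y⟫ - frobeniusInner (fderiv ℝ (W s) y) (fderiv ℝ (f s) y) +
      ⟪W s y + fderiv ℝ (W s) y y, f s y⟫)) I (volume : Measure ℝ) := by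
    have c₂ : Continuous fun z : ℝ × EuclideanSpace ℝ (Fin 3) =>
        ⟪W z.1 z.2, timeDeriv f z.1 z.2⟫ - frobeniusInner (fderiv ℝ (W z.1) z.2) (fderiv ℝ (f z.1) z.2) +
          ⟪W z.1 z.2 + fderiv ℝ (W z.1) z.2 z.2, f z.1 z.2⟫ := ((cW.inner cft).sub cfrob).add ((cW.add cDWy).inner cf)
    have hz₂ : ∀ z : ℝ × EuclideanSpace ℝ (Fin 3), z.2 ∉ B →
        ⟪W z.1 z.2, timeDeriv f z.1 z.2⟫ - frobeniusInner (fderiv ℝ (W z.1) z.2) (fderiv ℝ (f z.1) z.2) +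
          ⟪W z.1 z.2 + fderiv ℝ (W z.1) z.2 z.2, f z.1 z.2⟫ = 0 := by
      intro z hz
      obtain ⟨h1, h2, h3⟩ := hRf z.1 z.2 hz
      rw [h1, h2, h3, inner_zero_right, inner_zero_right, frobeniusInner_zero_right, sub_zero, add_zero]
    exact integrableOn_integral_slice c₂ hz₂ 0 T
  have hΛi : ∀ s, Integrable (fun y => ⟪W s y, timeDeriv f s y⟫ - frobeniusInner (fderiv ℝ (W s) y) (fderiv ℝ (f s) y) +
      ⟪W s y + fderiv ℝ (W s) y y, f s y⟫) (volume : Measure (EuclideanSpace ℝ (Fin 3))) := by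
    intro s
    have c₂ : Continuous fun z : ℝ × EuclideanSpace ℝ (Fin 3) =>
        ⟪W z.1 z.2, timeDeriv f z.1 z.2⟫ - frobeniusInner (fderiv ℝ (W z.1) z.2) (fderiv ℝ (f z.1) z.2) +
          ⟪W z.1 z.2 + fderiv ℝ (W z.1) z.2 z.2, f z.1 z.2⟫ := ((cW.inner cft).sub cfrob).add ((cW.add cDWy).inner cf)
    have hz₂ : ∀ z : ℝ × EuclideanSpace ℝ (Fin 3), z.2 ∉ B →
        ⟪W z.1 z.2, timeDeriv f z.1 z.2⟫ - frobeniusInner (fderiv ℝ (W z.1) z.2) (fderiv ℝ (f z.1) z.2) +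
          ⟪W z.1 z.2 + fderiv ℝ (W z.1) z.2 z.2, f z.1 z.2⟫ = 0 := by
      intro z hz
      obtain ⟨h1, h2, h3⟩ := hRf z.1 z.2 hz
      rw [h1, h2, h3, inner_zero_right, inner_zero_right, frobeniusInner_zero_right, sub_zero, add_zero]
    exact integrable_slice_of_continuous_of_ball c₂ hz₂ s
  -- ## the identity for each `k` on the cylinder
  have hOk_int : ∀ k, Integrable (fun z : ℝ × EuclideanSpace ℝ (Fin 3) =>
      ⟪U k z.1 z.2, timeDeriv f z.1 z.2⟫ - frobeniusInner (G k z.1 z.2) (fderiv ℝ (f z.1) z.2) +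
        ⟪U k z.1 z.2 + G k z.1 z.2 z.2 - G k z.1 z.2 (W z.1 z.2 + mollify η (ε k) (U k) z.1 z.2) -
          fderiv ℝ (W z.1) z.2 (U k z.1 z.2) - fderiv ℝ (W z.1) z.2 (W z.1 z.2), f z.1 z.2⟫) μQ := fun k =>
    ((hsplit (hUmem k) (hbkmem k) (hGkmem k)).1.congr (hrewrite (fun z => U k z.1 z.2)
      (fun z => W z.1 z.2 + mollify η (ε k) (U k) z.1 z.2) (fun z => G k z.1 z.2)).symm)
  have hk : ∀ k, (∫ z, ⟪U k z.1 z.2, timeDeriv f z.1 z.2⟫ ∂μQ) -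
      (∫ z, frobeniusInner (G k z.1 z.2) (fderiv ℝ (f z.1) z.2) ∂μQ) +
      (∫ z, ⟪U k z.1 z.2, f z.1 z.2⟫ ∂μQ) +
      (∫ z, frobeniusInner (G k z.1 z.2) ((innerSL ℝ z.2).smulRight (f z.1 z.2)) ∂μQ) -
      (∫ z, frobeniusInner (G k z.1 z.2) ((innerSL ℝ (W z.1 z.2 + mollify η (ε k) (U k) z.1 z.2)).smulRight (f z.1 z.2)) ∂μQ) -
      (∫ z, ⟪f z.1 z.2, L z (U k z.1 z.2)⟫ ∂μQ) - (∫ z, ⟪L z (W z.1 z.2), f z.1 z.2⟫ ∂μQ) =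
      ∫ s in I, lerayPairing W s (f s) := by
    intro k
    obtain ⟨ha, -, hfub⟩ := hfubini (O := fun s y => ⟪U k s y, timeDeriv f s y⟫ - frobeniusInner (G k s y) (fderiv ℝ (f s) y) +
        ⟪U k s y + G k s y y - G k s y (W s y + mollify η (ε k) (U k) s y) -
          fderiv ℝ (W s) y (U k s y) - fderiv ℝ (W s) y (W s y), f s y⟫) (hOk_int k)
      (fun z hz => hvanish (fun z => U k z.1 z.2) (fun z => W z.1 z.2 + mollify η (ε k) (U k) z.1 z.2) (fun z => G k z.1 z.2) z hz)
    have key : ∫ s in I, ((∫ y, (⟪U k s y, timeDeriv f s y⟫ - frobeniusInner (G k s y) (fderiv ℝ (f s) y) +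
        ⟪U k s y + G k s y y - G k s y (W s y + mollify η (ε k) (U k) s y) -
          fderiv ℝ (W s) y (U k s y) - fderiv ℝ (W s) y (W s y), f s y⟫)) - lerayPairing W s (f s)) = 0 := hGiii k f hf
    rw [integral_sub ha hLp, sub_eq_zero, hfub] at key
    rw [← key, ← (hsplit (hUmem k) (hbkmem k) (hGkmem k)).2]
    exact integral_congr_ae (hrewrite (fun z => U k z.1 z.2) (fun z => W z.1 z.2 + mollify η (ε k) (U k) z.1 z.2)
      (fun z => G k z.1 z.2)).symm
  -- ## the limits of the seven pieces
  have hl1 : Tendsto (fun k => ∫ z, ⟪U k z.1 z.2, timeDeriv f z.1 z.2⟫ ∂μQ) atTop (𝓝 (∫ z, ⟪Ul z.1 z.2, timeDeriv f z.1 z.2⟫ ∂μQ)) :=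
    tendsto_integral_inner_of_tendsto_eLpNorm_two_bdd hUmem hUlmem hconvU hwt hCft0 hCft
  have hl2 : Tendsto (fun k => ∫ z, frobeniusInner (G k z.1 z.2) (fderiv ℝ (f z.1) z.2) ∂μQ) atTop
      (𝓝 (∫ z, frobeniusInner (Gu z.1 z.2) (fderiv ℝ (f z.1) z.2) ∂μQ)) :=
    tendsto_integral_frobeniusInner (μ := μQ) (M := (C : ℝ≥0∞) ^ (1 / 2 : ℝ))
      (Γ := fun (k : ℕ) (z : ℝ × EuclideanSpace ℝ (Fin 3)) => G k z.1 z.2)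
      (Γ₀ := fun z : ℝ × EuclideanSpace ℝ (Fin 3) => Gu z.1 z.2)
      (R := fun (_ : ℕ) (z : ℝ × EuclideanSpace ℝ (Fin 3)) => fderiv ℝ (f z.1) z.2)
      (R₀ := fun z : ℝ × EuclideanSpace ℝ (Fin 3) => fderiv ℝ (f z.1) z.2)
      (fun k i => hcolm (hGm k) (stdOrthonormalBasis ℝ (EuclideanSpace ℝ (Fin 3)) i)) hCtop hGcol
      (fun i h hh => hGwQ (stdOrthonormalBasis ℝ (EuclideanSpace ℝ (Fin 3)) i) h hh) (fun _ i => hRDf i) hRDf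
      (fun i => by simp only [sub_self, eLpNorm_zero]; exact tendsto_const_nhds) hGumem
  have hl3 : Tendsto (fun k => ∫ z, ⟪U k z.1 z.2, f z.1 z.2⟫ ∂μQ) atTop (𝓝 (∫ z, ⟪Ul z.1 z.2, f z.1 z.2⟫ ∂μQ)) :=
    tendsto_integral_inner_of_tendsto_eLpNorm_two_bdd hUmem hUlmem hconvU hwf hCf0 hCf
  have hl4 : Tendsto (fun k => ∫ z, frobeniusInner (G k z.1 z.2) ((innerSL ℝ z.2).smulRight (f z.1 z.2)) ∂μQ) atTop
      (𝓝 (∫ z, frobeniusInner (Gu z.1 z.2) ((innerSL ℝ z.2).smulRight (f z.1 z.2)) ∂μQ)) :=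
    tendsto_integral_frobeniusInner (μ := μQ) (M := (C : ℝ≥0∞) ^ (1 / 2 : ℝ))
      (Γ := fun (k : ℕ) (z : ℝ × EuclideanSpace ℝ (Fin 3)) => G k z.1 z.2)
      (Γ₀ := fun z : ℝ × EuclideanSpace ℝ (Fin 3) => Gu z.1 z.2)
      (R := fun (_ : ℕ) (z : ℝ × EuclideanSpace ℝ (Fin 3)) => (innerSL ℝ z.2).smulRight (f z.1 z.2))
      (R₀ := fun z : ℝ × EuclideanSpace ℝ (Fin 3) => (innerSL ℝ z.2).smulRight (f z.1 z.2))
      (fun k i => hcolm (hGm k) (stdOrthonormalBasis ℝ (EuclideanSpace ℝ (Fin 3)) i)) hCtop hGcol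
      (fun i h hh => hGwQ (stdOrthonormalBasis ℝ (EuclideanSpace ℝ (Fin 3)) i) h hh) (fun _ i => hRy i) hRy
      (fun i => by simp only [sub_self, eLpNorm_zero]; exact tendsto_const_nhds) hGumem
  have hl5 : Tendsto (fun k => ∫ z, frobeniusInner (G k z.1 z.2)
      ((innerSL ℝ (W z.1 z.2 + mollify η (ε k) (U k) z.1 z.2)).smulRight (f z.1 z.2)) ∂μQ) atTop
      (𝓝 (∫ z, frobeniusInner (Gu z.1 z.2) ((innerSL ℝ (W z.1 z.2 + Ul z.1 z.2)).smulRight (f z.1 z.2)) ∂μQ)) := by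
    refine tendsto_integral_frobeniusInner (μ := μQ) (M := (C : ℝ≥0∞) ^ (1 / 2 : ℝ))
      (Γ := fun (k : ℕ) (z : ℝ × EuclideanSpace ℝ (Fin 3)) => G k z.1 z.2)
      (Γ₀ := fun z : ℝ × EuclideanSpace ℝ (Fin 3) => Gu z.1 z.2)
      (R := fun (k : ℕ) (z : ℝ × EuclideanSpace ℝ (Fin 3)) => (innerSL ℝ (W z.1 z.2 + mollify η (ε k) (U k) z.1 z.2)).smulRight (f z.1 z.2))
      (R₀ := fun z : ℝ × EuclideanSpace ℝ (Fin 3) => (innerSL ℝ (W z.1 z.2 + Ul z.1 z.2)).smulRight (f z.1 z.2))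
      (fun k i => hcolm (hGm k) (stdOrthonormalBasis ℝ (EuclideanSpace ℝ (Fin 3)) i)) hCtop hGcol
      (fun i h hh => hGwQ (stdOrthonormalBasis ℝ (EuclideanSpace ℝ (Fin 3)) i) h hh) (fun k i => hRb (hbkmem k) i) (hRb hbmem) ?_ hGumem
    intro i
    have hbd : ∀ k, eLpNorm ((fun z : ℝ × EuclideanSpace ℝ (Fin 3) =>
        ((innerSL ℝ (W z.1 z.2 + mollify η (ε k) (U k) z.1 z.2)).smulRight (f z.1 z.2)) (stdOrthonormalBasis ℝ (EuclideanSpace ℝ (Fin 3)) i)) -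
        fun z => ((innerSL ℝ (W z.1 z.2 + Ul z.1 z.2)).smulRight (f z.1 z.2)) (stdOrthonormalBasis ℝ (EuclideanSpace ℝ (Fin 3)) i)) 2 μQ ≤
        ENNReal.ofReal Cf * eLpNorm ((fun z : ℝ × EuclideanSpace ℝ (Fin 3) => W z.1 z.2 + mollify η (ε k) (U k) z.1 z.2) -
          fun z => W z.1 z.2 + Ul z.1 z.2) 2 μQ := by
      intro k
      refine eLpNorm_le_mul_eLpNorm_of_ae_le_mul (Eventually.of_forall fun z => ?_) 2
      simp only [Pi.sub_apply, ContinuousLinearMap.smulRight_apply, innerSL_apply_apply, ← sub_smul, ← inner_sub_left]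
      rw [norm_smul]
      calc ‖⟪W z.1 z.2 + mollify η (ε k) (U k) z.1 z.2 - (W z.1 z.2 + Ul z.1 z.2), stdOrthonormalBasis ℝ (EuclideanSpace ℝ (Fin 3)) i⟫‖ * ‖f z.1 z.2‖
          ≤ (‖W z.1 z.2 + mollify η (ε k) (U k) z.1 z.2 - (W z.1 z.2 + Ul z.1 z.2)‖ * ‖stdOrthonormalBasis ℝ (EuclideanSpace ℝ (Fin 3)) i‖) * Cf :=
            mul_le_mul (norm_inner_le_norm _ _) (hCf z) (norm_nonneg _) (by positivity)
        _ = Cf * ‖W z.1 z.2 + mollify η (ε k) (U k) z.1 z.2 - (W z.1 z.2 + Ul z.1 z.2)‖ := by rw [he1, mul_one, mul_comm]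
    have hlim : Tendsto (fun k => ENNReal.ofReal Cf * eLpNorm ((fun z : ℝ × EuclideanSpace ℝ (Fin 3) => W z.1 z.2 + mollify η (ε k) (U k) z.1 z.2) -
        fun z => W z.1 z.2 + Ul z.1 z.2) 2 μQ) atTop (𝓝 0) := by
      have h := ENNReal.Tendsto.const_mul hconvb (a := ENNReal.ofReal Cf) (Or.inr ENNReal.ofReal_ne_top)
      rwa [mul_zero] at h
    exact tendsto_of_tendsto_of_tendsto_of_le_of_le tendsto_const_nhds hlim (fun _ => zero_le) hbd
  have hl6 : Tendsto (fun k => ∫ z, ⟪f z.1 z.2, L z (U k z.1 z.2)⟫ ∂μQ) atTop (𝓝 (∫ z, ⟪f z.1 z.2, L z (Ul z.1 z.2)⟫ ∂μQ)) :=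
    tendsto_integral_inner_clm_apply₂ (μ := μQ) (f := fun (_ : ℕ) (z : ℝ × EuclideanSpace ℝ (Fin 3)) => f z.1 z.2)
      (f₀ := fun z : ℝ × EuclideanSpace ℝ (Fin 3) => f z.1 z.2)
      (g := fun (k : ℕ) (z : ℝ × EuclideanSpace ℝ (Fin 3)) => U k z.1 z.2) (g₀ := fun z : ℝ × EuclideanSpace ℝ (Fin 3) => Ul z.1 z.2)
      (L := L) (fun _ => hfmem) hfmem hUmem hUlmem hconvf hconvU hLm hMD0 hLM
  have hlim := (((((hl1.sub hl2).add hl3).add hl4).sub hl5).sub hl6).sub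
    (tendsto_const_nhds (x := ∫ z, ⟪L z (W z.1 z.2), f z.1 z.2⟫ ∂μQ))
  simp only [hk] at hlim
  have hlimit_eq := tendsto_nhds_unique tendsto_const_nhds hlim
  -- `∫_S O_∞ = ∫_I ⟨LW, f⟩`
  have hO_int : Integrable (fun z : ℝ × EuclideanSpace ℝ (Fin 3) =>
      ⟪Ul z.1 z.2, timeDeriv f z.1 z.2⟫ - frobeniusInner (Gu z.1 z.2) (fderiv ℝ (f z.1) z.2) +
        ⟪Ul z.1 z.2 + Gu z.1 z.2 z.2 - Gu z.1 z.2 (W z.1 z.2 + Ul z.1 z.2) -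
          fderiv ℝ (W z.1) z.2 (Ul z.1 z.2) - fderiv ℝ (W z.1) z.2 (W z.1 z.2), f z.1 z.2⟫) μQ :=
    ((hsplit hUlmem hbmem hGumem).1.congr (hrewrite (fun z => Ul z.1 z.2) (fun z => W z.1 z.2 + Ul z.1 z.2) (fun z => Gu z.1 z.2)).symm)
  have hO_eq : ∫ z, (⟪Ul z.1 z.2, timeDeriv f z.1 z.2⟫ - frobeniusInner (Gu z.1 z.2) (fderiv ℝ (f z.1) z.2) +
        ⟪Ul z.1 z.2 + Gu z.1 z.2 z.2 - Gu z.1 z.2 (W z.1 z.2 + Ul z.1 z.2) -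
          fderiv ℝ (W z.1) z.2 (Ul z.1 z.2) - fderiv ℝ (W z.1) z.2 (W z.1 z.2), f z.1 z.2⟫) ∂μQ =
      ∫ s in I, lerayPairing W s (f s) := by
    rw [integral_congr_ae (hrewrite (fun z => Ul z.1 z.2) (fun z => W z.1 z.2 + Ul z.1 z.2) (fun z => Gu z.1 z.2)),
      (hsplit hUlmem hbmem hGumem).2]
    exact hlimit_eq.symm
  -- ## the target: `∫_I ∫ (O_∞ + Λ) = ∫_I (⟨LW, f⟩ + ∫Λ) = ∫_I d/ds ∫⟪W, f⟫ = 0`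
  obtain ⟨ha, hae, hfub⟩ := hfubini (O := fun s y => ⟪Ul s y, timeDeriv f s y⟫ - frobeniusInner (Gu s y) (fderiv ℝ (f s) y) +
      ⟪Ul s y + Gu s y y - Gu s y (W s y + Ul s y) - fderiv ℝ (W s) y (Ul s y) - fderiv ℝ (W s) y (W s y), f s y⟫) hO_int
    (fun z hz => hvanish (fun z => Ul z.1 z.2) (fun z => W z.1 z.2 + Ul z.1 z.2) (fun z => Gu z.1 z.2) z hz)
  -- pointwise: target integrand = `O_∞ + Λ`
  have hpt : ∀ s y, ⟪Ul s y + W s y, timeDeriv f s y⟫ - frobeniusInner (Gu s y + fderiv ℝ (W s) y) (fderiv ℝ (f s) y) +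
      ⟪Ul s y + W s y + (Gu s y + fderiv ℝ (W s) y) y - (Gu s y + fderiv ℝ (W s) y) (Ul s y + W s y), f s y⟫ =
      (⟪Ul s y, timeDeriv f s y⟫ - frobeniusInner (Gu s y) (fderiv ℝ (f s) y) +
        ⟪Ul s y + Gu s y y - Gu s y (W s y + Ul s y) - fderiv ℝ (W s) y (Ul s y) - fderiv ℝ (W s) y (W s y), f s y⟫) +
      (⟪W s y, timeDeriv f s y⟫ - frobeniusInner (fderiv ℝ (W s) y) (fderiv ℝ (f s) y) + ⟪W s y + fderiv ℝ (W s) y y, f s y⟫) := by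
    intro s y
    rw [frobeniusInner_add_left, add_comm (W s y) (Ul s y)]
    simp only [_root_.add_apply, map_add, inner_add_left, inner_sub_left]
    ring
  have hstep1 : ∫ s in I, ∫ y, (⟪Ul s y + W s y, timeDeriv f s y⟫ - frobeniusInner (Gu s y + fderiv ℝ (W s) y) (fderiv ℝ (f s) y) +
      ⟪Ul s y + W s y + (Gu s y + fderiv ℝ (W s) y) y - (Gu s y + fderiv ℝ (W s) y) (Ul s y + W s y), f s y⟫) =
      ∫ s in I, ((∫ y, (⟪Ul s y, timeDeriv f s y⟫ - frobeniusInner (Gu s y) (fderiv ℝ (f s) y) +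
        ⟪Ul s y + Gu s y y - Gu s y (W s y + Ul s y) - fderiv ℝ (W s) y (Ul s y) - fderiv ℝ (W s) y (W s y), f s y⟫)) +
        ∫ y, (⟪W s y, timeDeriv f s y⟫ - frobeniusInner (fderiv ℝ (W s) y) (fderiv ℝ (f s) y) + ⟪W s y + fderiv ℝ (W s) y y, f s y⟫)) := by
    refine integral_congr_ae ?_
    filter_upwards [hae] with s hs
    simp only [hpt]
    exact integral_add hs (hΛi s)
  rw [hstep1, integral_add ha hΛ, hfub, hO_eq, ← integral_add hLp hΛ]
  simp only [lerayPairing_add_integral_eq hW hf1 hRf]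
  exact integral_Ioo_deriv_pairing_eq_zero hT hW hWper hf1 hf.periodic hRf

end WeakFormLimit

end BradshawTsai2017

end Literature.Analysis.FluidPDE

end
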